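import Literature.Computability.MetaComplexity.EFModAddAssocRules
import HarnessLib

/-!
# Modular addition in extended Frege: associativity, I — the identity between ordinary sums

Layer D/4b of the `EF`-proof construction kit. For the four occurrences of the associativity law
`o₁ = x ⊕ₙ y` (result `u₁`), `o₂ = u₁ ⊕ₙ z` (result `L`), `o₃ = y ⊕ₙ z` (result `u₃`),
`o₄ = x ⊕ₙ u₃` (result `R`), with their split adders `Pⱼ = zext(uⱼ) + zext(Gⱼ ∧ n)`
(`EFModAddSplit.lean`, `P₂ = L' + N₂`, `P₄ = R' + N₄`), this file derives inside Frege the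
identity of `(W+2)`-bit sums

  `VL = (L' + N₂) + N₁ ≡ (x + y) + z ≡ x + (y + z) ≡ (R' + N₄) + N₃ = VR`

(`ModAdd.AssocMain.main`: the sum bits of the adders `VL`, `VR` of the auxiliary template
`ModAdd.mainAuxT` are provably equal), from the split identities of the four occurrences: adder
associativity (`Adder.AssocData`, three times), commutativity, congruence, and the bookkeeping of
zero-extended top positions. The equality of quotients and the final cancellation follow in the
sequels.

## Sources

* S. A. Cook, R. A. Reckhow, *The relative efficiency of propositional proof systems*,
  J. Symbolic Logic 44 (1979), §2 (sound schematic rules).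
* J. Krajíček, *Bounded Arithmetic, Propositional Logic, and Complexity Theory* (CUP 1995), §9.2.
-/

namespace Literature.Computability.MetaComplexity

open _root_.Computability Complexity Complexity.PropForm FregeSystem Netlist

namespace ModAdd

/-! ### The auxiliary template

Inputs (`12W + 12`): `x` (`0…`), `z` (`W…`), `u₁` (`2W…`), `u₃` (`3W…`), the sum word `S₁` of `o₁`
(`4W…5W`, last the carry-out), `S₃` of `o₃` (`5W+1…6W+1`), the sum bits and carry of `P₁`
(`6W+2…7W+3`), the masks of `o₁` (`7W+4…8W+3`), the `⊥` gate `f₁` of `o₁` (`8W+4`), sum bits and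
carry of `P₂` (`8W+5…9W+6`), of `P₃` (`9W+7…10W+8`), the masks of `o₃` (`10W+9…11W+8`), the `⊥`
gate `f₃` of `o₃` (`11W+9`), sum bits and carry of `P₄` (`11W+10…12W+11`). -/

namespace AssocMain

/-- Wiring of `TA = S₁ + z` (`W+1` bits). [folklore] -/
def wTA (W i : ℕ) : ℕ ⊕ ℕ :=
  if i < W + 1 then Sum.inl (4 * W + i) else if i < 2 * W + 1 then Sum.inl (W + (i - (W + 1))) else Sum.inl (8 * W + 4)

/-- Wiring of `B₂ = zext(z) + (U₁ + N₁)` (`W+2` bits). [folklore] -/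
def wB2 (W i : ℕ) : ℕ ⊕ ℕ :=
  if i < W then Sum.inl (W + i) else if i < W + 2 then Sum.inl (8 * W + 4) else Sum.inl (6 * W + 2 + (i - (W + 2)))

/-- Wiring of `ZU = z + u₁` (`W+1` bits). [folklore] -/
def wZU (W i : ℕ) : ℕ ⊕ ℕ :=
  if i < W then Sum.inl (W + i) else if i = W then Sum.inl (8 * W + 4)
  else if i < 2 * W + 1 then Sum.inl (2 * W + (i - (W + 1))) else Sum.inl (8 * W + 4)

/-- Wiring of `BZ = (z + u₁) + N₁` (`W+2` bits). [folklore] -/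
def wBZ (W i : ℕ) : ℕ ⊕ ℕ :=
  if i < W + 1 then Sum.inr (4 * W + 8 + (2 * i + 1)) else if i = W + 1 then Sum.inr (4 * W + 8 + 2 * (W + 1))
  else if i < 2 * W + 2 then Sum.inl (7 * W + 4 + (i - (W + 2))) else Sum.inl (8 * W + 4)

/-- Wiring of `VL = (L' + N₂) + N₁` (`W+2` bits). [folklore] -/
def wVL (W i : ℕ) : ℕ ⊕ ℕ :=
  if i < W + 2 then Sum.inl (8 * W + 5 + i) else if i < 2 * W + 2 then Sum.inl (7 * W + 4 + (i - (W + 2))) else Sum.inl (8 * W + 4)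

/-- Wiring of `TB = x + S₃` (`W+1` bits). [folklore] -/
def wTB (W i : ℕ) : ℕ ⊕ ℕ :=
  if i < W then Sum.inl i else if i = W then Sum.inl (8 * W + 4) else Sum.inl (5 * W + 1 + (i - (W + 1)))

/-- Wiring of `Q₃ = x + u₃` (`W+1` bits). [folklore] -/
def wQ3 (W i : ℕ) : ℕ ⊕ ℕ :=
  if i < W then Sum.inl i else if i = W then Sum.inl (8 * W + 4)
  else if i < 2 * W + 1 then Sum.inl (3 * W + (i - (W + 1))) else Sum.inl (11 * W + 9)

/-- Wiring of `VRp = (x + u₃) + N₃` (`W+2` bits). [folklore] -/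
def wVRp (W i : ℕ) : ℕ ⊕ ℕ :=
  if i < W + 1 then Sum.inr (12 * W + 24 + (2 * i + 1)) else if i = W + 1 then Sum.inr (12 * W + 24 + 2 * (W + 1))
  else if i < 2 * W + 2 then Sum.inl (10 * W + 9 + (i - (W + 2))) else if i = 2 * W + 2 then Sum.inl (11 * W + 9)
  else Sum.inl (8 * W + 4)

/-- Wiring of `TB' = zext(x) + (U₃ + N₃)` (`W+2` bits). [folklore] -/
def wTBp (W i : ℕ) : ℕ ⊕ ℕ :=
  if i < W then Sum.inl i else if i < W + 2 then Sum.inl (8 * W + 4) else Sum.inl (9 * W + 7 + (i - (W + 2)))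

/-- Wiring of `VR = (R' + N₄) + N₃` (`W+2` bits). [folklore] -/
def wVR (W i : ℕ) : ℕ ⊕ ℕ :=
  if i < W + 2 then Sum.inl (11 * W + 10 + i) else if i < 2 * W + 2 then Sum.inl (10 * W + 9 + (i - (W + 2)))
  else if i = 2 * W + 2 then Sum.inl (11 * W + 9) else Sum.inl (8 * W + 4)

/-- The ten adders. [cite: Vollmer1999, §1.2] -/
def pieces (W : ℕ) : ℕ → Piece
  | 0 => ⟨Adder.addT false (W + 1), 2 * (W + 1), wTA W⟩
  | 1 => ⟨Adder.addT false (W + 2), 2 * (W + 2), wB2 W⟩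
  | 2 => ⟨Adder.addT false (W + 1), 2 * (W + 1), wZU W⟩
  | 3 => ⟨Adder.addT false (W + 2), 2 * (W + 2), wBZ W⟩
  | 4 => ⟨Adder.addT false (W + 2), 2 * (W + 2), wVL W⟩
  | 5 => ⟨Adder.addT false (W + 1), 2 * (W + 1), wTB W⟩
  | 6 => ⟨Adder.addT false (W + 1), 2 * (W + 1), wQ3 W⟩
  | 7 => ⟨Adder.addT false (W + 2), 2 * (W + 2), wVRp W⟩
  | 8 => ⟨Adder.addT false (W + 2), 2 * (W + 2), wTBp W⟩
  | _ => ⟨Adder.addT false (W + 2), 2 * (W + 2), wVR W⟩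

end AssocMain

/-- **The auxiliary template of the identity between sums.** [cite: Vollmer1999, §1.2] -/
def mainAuxT (W : ℕ) : Template := layout (AssocMain.pieces W) 10

namespace AssocMain

/-- The offsets of the ten adders. [folklore] -/
theorem offsets (W : ℕ) :
    offset (pieces W) 1 = 2 * W + 3 ∧ offset (pieces W) 2 = 4 * W + 8 ∧ offset (pieces W) 3 = 6 * W + 11 ∧
    offset (pieces W) 4 = 8 * W + 16 ∧ offset (pieces W) 5 = 10 * W + 21 ∧ offset (pieces W) 6 = 12 * W + 24 ∧
    offset (pieces W) 7 = 14 * W + 27 ∧ offset (pieces W) 8 = 16 * W + 32 ∧ offset (pieces W) 9 = 18 * W + 37 ∧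
    offset (pieces W) 10 = 20 * W + 42 := by
  have h1 : offset (pieces W) 1 = 2 * W + 3 := by rw [offset_succ, offset_zero]; simp [pieces]; ring
  have h2 : offset (pieces W) 2 = 4 * W + 8 := by rw [offset_succ, h1]; simp [pieces]; ring
  have h3 : offset (pieces W) 3 = 6 * W + 11 := by rw [offset_succ, h2]; simp [pieces]; ring
  have h4 : offset (pieces W) 4 = 8 * W + 16 := by rw [offset_succ, h3]; simp [pieces]; ring
  have h5 : offset (pieces W) 5 = 10 * W + 21 := by rw [offset_succ, h4]; simp [pieces]; ring
  have h6 : offset (pieces W) 6 = 12 * W + 24 := by rw [offset_succ, h5]; simp [pieces]; ring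
  have h7 : offset (pieces W) 7 = 14 * W + 27 := by rw [offset_succ, h6]; simp [pieces]; ring
  have h8 : offset (pieces W) 8 = 16 * W + 32 := by rw [offset_succ, h7]; simp [pieces]; ring
  have h9 : offset (pieces W) 9 = 18 * W + 37 := by rw [offset_succ, h8]; simp [pieces]; ring
  have h10 : offset (pieces W) 10 = 20 * W + 42 := by rw [offset_succ, h9]; simp [pieces]; ring
  exact ⟨h1, h2, h3, h4, h5, h6, h7, h8, h9, h10⟩

/-- A piece is well wired as soon as each wiring value is an input `< 12W+12` or a gate below the
offset. [folklore] -/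
theorem ok_of (W : ℕ) {k : ℕ} {T : Template} {m : ℕ} {w : ℕ → ℕ ⊕ ℕ} (hP : pieces W k = ⟨T, m, w⟩) (hwf : T.WF m)
    (h : ∀ i < m, (∀ a, w i = Sum.inl a → a < 12 * W + 12) ∧ (∀ g, w i = Sum.inr g → g < offset (pieces W) k)) :
    Piece.OK (pieces W) (12 * W + 12) k := by
  unfold Piece.OK; rw [hP]; exact ⟨hwf, h⟩

/-- Every piece is well formed and well wired. [cite: Vollmer1999, Def. 1.6] -/
theorem piece_ok (W : ℕ) : ∀ k < 10, Piece.OK (pieces W) (12 * W + 12) k := by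
  obtain ⟨h1, h2, h3, h4, h5, h6, h7, h8, h9, -⟩ := offsets W
  intro k hk
  have hk' : k = 0 ∨ k = 1 ∨ k = 2 ∨ k = 3 ∨ k = 4 ∨ k = 5 ∨ k = 6 ∨ k = 7 ∨ k = 8 ∨ k = 9 := by omega
  rcases hk' with rfl | rfl | rfl | rfl | rfl | rfl | rfl | rfl | rfl | rfl
  · refine ok_of W rfl (Adder.wf_addT false (W + 1)) fun i hi => ?_
    unfold wTA; split_ifs <;> exact ⟨fun a ha => by cases ha; omega, fun g hg => by cases hg⟩
  · refine ok_of W rfl (Adder.wf_addT false (W + 2)) fun i hi => ?_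
    unfold wB2; split_ifs <;> exact ⟨fun a ha => by cases ha; omega, fun g hg => by cases hg⟩
  · refine ok_of W rfl (Adder.wf_addT false (W + 1)) fun i hi => ?_
    unfold wZU; split_ifs <;> exact ⟨fun a ha => by cases ha; omega, fun g hg => by cases hg⟩
  · refine ok_of W rfl (Adder.wf_addT false (W + 2)) fun i hi => ?_
    rw [h3]; unfold wBZ; split_ifs <;> first
      | exact ⟨fun a ha => by cases ha; omega, fun g hg => by cases hg⟩
      | exact ⟨fun a ha => (by cases ha), fun g hg => by cases hg; omega⟩
  · refine ok_of W rfl (Adder.wf_addT false (W + 2)) fun i hi => ?_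
    unfold wVL; split_ifs <;> exact ⟨fun a ha => by cases ha; omega, fun g hg => by cases hg⟩
  · refine ok_of W rfl (Adder.wf_addT false (W + 1)) fun i hi => ?_
    unfold wTB; split_ifs <;> exact ⟨fun a ha => by cases ha; omega, fun g hg => by cases hg⟩
  · refine ok_of W rfl (Adder.wf_addT false (W + 1)) fun i hi => ?_
    unfold wQ3; split_ifs <;> exact ⟨fun a ha => by cases ha; omega, fun g hg => by cases hg⟩
  · refine ok_of W rfl (Adder.wf_addT false (W + 2)) fun i hi => ?_
    rw [h7]; unfold wVRp; split_ifs <;> first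
      | exact ⟨fun a ha => by cases ha; omega, fun g hg => by cases hg⟩
      | exact ⟨fun a ha => (by cases ha), fun g hg => by cases hg; omega⟩
  · refine ok_of W rfl (Adder.wf_addT false (W + 2)) fun i hi => ?_
    unfold wTBp; split_ifs <;> exact ⟨fun a ha => by cases ha; omega, fun g hg => by cases hg⟩
  · refine ok_of W rfl (Adder.wf_addT false (W + 2)) fun i hi => ?_
    unfold wVR; split_ifs <;> exact ⟨fun a ha => by cases ha; omega, fun g hg => by cases hg⟩

end AssocMain

/-- **The auxiliary template is well formed** (`12W + 12` inputs). [cite: Vollmer1999, Def. 1.6] -/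
theorem wf_mainAuxT (W : ℕ) : (mainAuxT W).WF (12 * W + 12) := wf_layout (AssocMain.pieces W) (AssocMain.piece_ok W)

/-- Size of the auxiliary template: `20W + 42` gates. [folklore] -/
@[simp] theorem length_mainAuxT (W : ℕ) : (mainAuxT W).length = 20 * W + 42 := by
  rw [mainAuxT, length_layout]; exact (AssocMain.offsets W).2.2.2.2.2.2.2.2.2

/-! ### Views of the auxiliary occurrence -/

namespace AssocMain

open SplitAux

/-- Evaluation of the wirings (for `mainAvail`). [folklore] -/
theorem wTA_x (W : ℕ) {i : ℕ} (hi : i < W + 1) : wTA W i = Sum.inl (4 * W + i) := by simp [wTA, hi]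
/-- Evaluation of the wirings. [folklore] -/
theorem wTA_yl (W : ℕ) {j : ℕ} (hj : j < W) : wTA W (W + 1 + j) = Sum.inl (W + j) := by
  unfold wTA; rw [if_neg (by omega), if_pos (by omega)]; congr 1; omega
/-- Evaluation of the wirings. [folklore] -/
theorem wTA_yh (W : ℕ) : wTA W (W + 1 + W) = Sum.inl (8 * W + 4) := by
  unfold wTA; rw [if_neg (by omega), if_neg (by omega)]
/-- Evaluation of the wirings. [folklore] -/
theorem wB2_xl (W : ℕ) {j : ℕ} (hj : j < W) : wB2 W j = Sum.inl (W + j) := by simp [wB2, hj]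
/-- Evaluation of the wirings. [folklore] -/
theorem wB2_xh (W : ℕ) {j : ℕ} (hj : W ≤ j) (hj' : j < W + 2) : wB2 W j = Sum.inl (8 * W + 4) := by
  unfold wB2; rw [if_neg (by omega), if_pos hj']
/-- Evaluation of the wirings. [folklore] -/
theorem wB2_y (W : ℕ) (j : ℕ) : wB2 W (W + 2 + j) = Sum.inl (6 * W + 2 + j) := by
  unfold wB2; rw [if_neg (by omega), if_neg (by omega)]; congr 1; omega
/-- Evaluation of the wirings. [folklore] -/
theorem wZU_xl (W : ℕ) {j : ℕ} (hj : j < W) : wZU W j = Sum.inl (W + j) := by simp [wZU, hj]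
/-- Evaluation of the wirings. [folklore] -/
theorem wZU_xh (W : ℕ) : wZU W W = Sum.inl (8 * W + 4) := by simp [wZU]
/-- Evaluation of the wirings. [folklore] -/
theorem wZU_yl (W : ℕ) {j : ℕ} (hj : j < W) : wZU W (W + 1 + j) = Sum.inl (2 * W + j) := by
  unfold wZU; rw [if_neg (by omega), if_neg (by omega), if_pos (by omega)]; congr 1; omega
/-- Evaluation of the wirings. [folklore] -/
theorem wZU_yh (W : ℕ) : wZU W (W + 1 + W) = Sum.inl (8 * W + 4) := by
  unfold wZU; rw [if_neg (by omega), if_neg (by omega), if_neg (by omega)]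
/-- Evaluation of the wirings. [folklore] -/
theorem wBZ_xl (W : ℕ) {j : ℕ} (hj : j < W + 1) : wBZ W j = Sum.inr (4 * W + 8 + (2 * j + 1)) := by simp [wBZ, hj]
/-- Evaluation of the wirings. [folklore] -/
theorem wBZ_xh (W : ℕ) : wBZ W (W + 1) = Sum.inr (4 * W + 8 + 2 * (W + 1)) := by simp [wBZ]
/-- Evaluation of the wirings. [folklore] -/
theorem wBZ_yl (W : ℕ) {j : ℕ} (hj : j < W) : wBZ W (W + 2 + j) = Sum.inl (7 * W + 4 + j) := by
  unfold wBZ; rw [if_neg (by omega), if_neg (by omega), if_pos (by omega)]; congr 1; omega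
/-- Evaluation of the wirings. [folklore] -/
theorem wBZ_yh (W : ℕ) {j : ℕ} (hj : W ≤ j) : wBZ W (W + 2 + j) = Sum.inl (8 * W + 4) := by
  unfold wBZ; rw [if_neg (by omega), if_neg (by omega), if_neg (by omega)]
/-- Evaluation of the wirings. [folklore] -/
theorem wVL_x (W : ℕ) {j : ℕ} (hj : j < W + 2) : wVL W j = Sum.inl (8 * W + 5 + j) := by simp [wVL, hj]
/-- Evaluation of the wirings. [folklore] -/
theorem wVL_yl (W : ℕ) {j : ℕ} (hj : j < W) : wVL W (W + 2 + j) = Sum.inl (7 * W + 4 + j) := by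
  unfold wVL; rw [if_neg (by omega), if_pos (by omega)]; congr 1; omega
/-- Evaluation of the wirings. [folklore] -/
theorem wVL_yh (W : ℕ) {j : ℕ} (hj : W ≤ j) : wVL W (W + 2 + j) = Sum.inl (8 * W + 4) := by
  unfold wVL; rw [if_neg (by omega), if_neg (by omega)]
/-- Evaluation of the wirings. [folklore] -/
theorem wTB_xl (W : ℕ) {j : ℕ} (hj : j < W) : wTB W j = Sum.inl j := by simp [wTB, hj]
/-- Evaluation of the wirings. [folklore] -/
theorem wTB_xh (W : ℕ) : wTB W W = Sum.inl (8 * W + 4) := by simp [wTB]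
/-- Evaluation of the wirings. [folklore] -/
theorem wTB_y (W : ℕ) (j : ℕ) : wTB W (W + 1 + j) = Sum.inl (5 * W + 1 + j) := by
  unfold wTB; rw [if_neg (by omega), if_neg (by omega)]; congr 1; omega
/-- Evaluation of the wirings. [folklore] -/
theorem wQ3_xl (W : ℕ) {j : ℕ} (hj : j < W) : wQ3 W j = Sum.inl j := by simp [wQ3, hj]
/-- Evaluation of the wirings. [folklore] -/
theorem wQ3_xh (W : ℕ) : wQ3 W W = Sum.inl (8 * W + 4) := by simp [wQ3]
/-- Evaluation of the wirings. [folklore] -/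
theorem wQ3_yl (W : ℕ) {j : ℕ} (hj : j < W) : wQ3 W (W + 1 + j) = Sum.inl (3 * W + j) := by
  unfold wQ3; rw [if_neg (by omega), if_neg (by omega), if_pos (by omega)]; congr 1; omega
/-- Evaluation of the wirings. [folklore] -/
theorem wQ3_yh (W : ℕ) : wQ3 W (W + 1 + W) = Sum.inl (11 * W + 9) := by
  unfold wQ3; rw [if_neg (by omega), if_neg (by omega), if_neg (by omega)]
/-- Evaluation of the wirings. [folklore] -/
theorem wVRp_xl (W : ℕ) {j : ℕ} (hj : j < W + 1) : wVRp W j = Sum.inr (12 * W + 24 + (2 * j + 1)) := by simp [wVRp, hj]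
/-- Evaluation of the wirings. [folklore] -/
theorem wVRp_xh (W : ℕ) : wVRp W (W + 1) = Sum.inr (12 * W + 24 + 2 * (W + 1)) := by simp [wVRp]
/-- Evaluation of the wirings. [folklore] -/
theorem wVRp_yl (W : ℕ) {j : ℕ} (hj : j < W) : wVRp W (W + 2 + j) = Sum.inl (10 * W + 9 + j) := by
  unfold wVRp; rw [if_neg (by omega), if_neg (by omega), if_pos (by omega)]; congr 1; omega
/-- Evaluation of the wirings. [folklore] -/
theorem wVRp_ym (W : ℕ) : wVRp W (W + 2 + W) = Sum.inl (11 * W + 9) := by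
  unfold wVRp; rw [if_neg (by omega), if_neg (by omega), if_neg (by omega), if_pos (by omega)]
/-- Evaluation of the wirings. [folklore] -/
theorem wVRp_yh (W : ℕ) : wVRp W (W + 2 + (W + 1)) = Sum.inl (8 * W + 4) := by
  unfold wVRp; rw [if_neg (by omega), if_neg (by omega), if_neg (by omega), if_neg (by omega)]
/-- Evaluation of the wirings. [folklore] -/
theorem wTBp_xl (W : ℕ) {j : ℕ} (hj : j < W) : wTBp W j = Sum.inl j := by simp [wTBp, hj]
/-- Evaluation of the wirings. [folklore] -/
theorem wTBp_xh (W : ℕ) {j : ℕ} (hj : W ≤ j) (hj' : j < W + 2) : wTBp W j = Sum.inl (8 * W + 4) := by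
  unfold wTBp; rw [if_neg (by omega), if_pos hj']
/-- Evaluation of the wirings. [folklore] -/
theorem wTBp_y (W : ℕ) (j : ℕ) : wTBp W (W + 2 + j) = Sum.inl (9 * W + 7 + j) := by
  unfold wTBp; rw [if_neg (by omega), if_neg (by omega)]; congr 1; omega
/-- Evaluation of the wirings. [folklore] -/
theorem wVR_x (W : ℕ) {j : ℕ} (hj : j < W + 2) : wVR W j = Sum.inl (11 * W + 10 + j) := by simp [wVR, hj]
/-- Evaluation of the wirings. [folklore] -/
theorem wVR_yl (W : ℕ) {j : ℕ} (hj : j < W) : wVR W (W + 2 + j) = Sum.inl (10 * W + 9 + j) := by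
  unfold wVR; rw [if_neg (by omega), if_pos (by omega)]; congr 1; omega
/-- Evaluation of the wirings. [folklore] -/
theorem wVR_ym (W : ℕ) : wVR W (W + 2 + W) = Sum.inl (11 * W + 9) := by
  unfold wVR; rw [if_neg (by omega), if_neg (by omega), if_pos (by omega)]
/-- Evaluation of the wirings. [folklore] -/
theorem wVR_yh (W : ℕ) : wVR W (W + 2 + (W + 1)) = Sum.inl (8 * W + 4) := by
  unfold wVR; rw [if_neg (by omega), if_neg (by omega), if_neg (by omega)]

variable (W : ℕ) (o₁ o₂ o₃ o₄ b₁ b₂ b₃ b₄ m : Occ)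

/-- `Z = zext(z)` with the `⊥` gate of `o₁`. [folklore] -/
def Z : ℕ → ℕ := Adder.zext (fun i => o₂.inp (W + i)) (f W o₁) W
/-- `X = zext(x)`. [folklore] -/
def X : ℕ → ℕ := Adder.zext o₁.inp (f W o₁) W
/-- `U₁ = zext(u₁)`. [folklore] -/
def U₁ : ℕ → ℕ := Adder.zext (u W o₁) (f W o₁) W
/-- `N₁ = zext(G₁ ∧ n)`. [folklore] -/
def N₁ : ℕ → ℕ := Adder.zext (M b₁) (f W o₁) W
/-- `U₃ = zext(u₃)` (with the `⊥` gate of `o₃`). [folklore] -/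
def U₃ : ℕ → ℕ := Adder.zext (u W o₃) (f W o₃) W
/-- `N₃ = zext(G₃ ∧ n)` (with the `⊥` gate of `o₃`). [folklore] -/
def N₃ : ℕ → ℕ := Adder.zext (M b₃) (f W o₃) W

/-- The associativity data `(x + y) + z = x + (y + z)`: `A = o₁`'s adder, `B = TA`, `C = o₃`'s adder,
`D = TB`. [folklore] -/
def d₀ : Adder.AssocData :=
  ⟨o₁.base, m.base, o₃.base, m.base + (10 * W + 21), o₁.inp, fun i => o₁.inp (W + i), fun i => o₂.inp (W + i), f W o₁, W⟩

/-- The associativity data `(Z + U₁) + N₁ = Z + (U₁ + N₁)`: `A = ZU`, `B = BZ`, `C = P₁`, `D = B₂`.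
[folklore] -/
def d₂ : Adder.AssocData :=
  ⟨m.base + (4 * W + 8), m.base + (6 * W + 11), b₁.base + W, m.base + (2 * W + 3), Z W o₁ o₂, U₁ W o₁, N₁ W o₁ b₁, f W o₁, W + 1⟩

/-- The associativity data `(X + U₃) + N₃ = X + (U₃ + N₃)`: `A = Q₃`, `B = VRp`, `C = P₃`, `D = TB'`.
[folklore] -/
def d₃ : Adder.AssocData :=
  ⟨m.base + (12 * W + 24), m.base + (14 * W + 27), b₃.base + W, m.base + (16 * W + 32), X W o₁, U₃ W o₃, N₃ W o₃ b₃, f W o₁,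
    W + 1⟩

/-- `VL = (L' + N₂) + N₁` on `W+2` bits. [folklore] -/
def VL : Adder.View := ⟨m.base + (8 * W + 16), Adder.extOut (P W o₂ b₂) (W + 1), Adder.zext (N₁ W o₁ b₁) (f W o₁) (W + 1)⟩

/-- `VR = (R' + N₄) + N₃` on `W+2` bits. [folklore] -/
def VR : Adder.View := ⟨m.base + (18 * W + 37), Adder.extOut (P W o₄ b₄) (W + 1), Adder.zext (N₃ W o₃ b₃) (f W o₁) (W + 1)⟩

/-- `MWired`: the inputs of the auxiliary occurrence `m` read the intended wires of the four
occurrences and their split adders. [folklore] -/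
structure MWired : Prop where
  /-- `x` -/
  hx : ∀ i < W, m.inp i = o₁.inp i
  /-- `z` -/
  hz : ∀ i < W, m.inp (W + i) = o₂.inp (W + i)
  /-- `u₁` -/
  hu₁ : ∀ i < W, m.inp (2 * W + i) = u W o₁ i
  /-- `u₃` -/
  hu₃ : ∀ i < W, m.inp (3 * W + i) = u W o₃ i
  /-- the sum word of `o₁` -/
  hS₁ : ∀ i < W + 1, m.inp (4 * W + i) = Adder.extOut (A W o₁) W i
  /-- the sum word of `o₃` -/
  hS₃ : ∀ i < W + 1, m.inp (5 * W + 1 + i) = Adder.extOut (A W o₃) W i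
  /-- the output word of `P₁` -/
  hP₁ : ∀ i < W + 2, m.inp (6 * W + 2 + i) = Adder.extOut (P W o₁ b₁) (W + 1) i
  /-- the masks of `o₁` -/
  hM₁ : ∀ i < W, m.inp (7 * W + 4 + i) = M b₁ i
  /-- the `⊥` gate of `o₁` -/
  hf₁ : m.inp (8 * W + 4) = f W o₁
  /-- the output word of `P₂` -/
  hP₂ : ∀ i < W + 2, m.inp (8 * W + 5 + i) = Adder.extOut (P W o₂ b₂) (W + 1) i
  /-- the output word of `P₃` -/
  hP₃ : ∀ i < W + 2, m.inp (9 * W + 7 + i) = Adder.extOut (P W o₃ b₃) (W + 1) i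
  /-- the masks of `o₃` -/
  hM₃ : ∀ i < W, m.inp (10 * W + 9 + i) = M b₃ i
  /-- the `⊥` gate of `o₃` -/
  hf₃ : m.inp (11 * W + 9) = f W o₃
  /-- the output word of `P₄` -/
  hP₄ : ∀ i < W + 2, m.inp (11 * W + 10 + i) = Adder.extOut (P W o₄ b₄) (W + 1) i

/-- `MainViews`: the definition lines of the ten adders are available. [folklore] -/
structure MainViews (K : PropForm ℕ) (Γ : Set (PropForm ℕ)) : Prop where
  /-- `TA` -/
  ta : (d₀ W o₁ o₂ o₃ m).B.Avail K Γ false (W + 1)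
  /-- `B₂` -/
  b2 : (d₂ W o₁ o₂ b₁ m).D.Avail K Γ false (W + 2)
  /-- `ZU` -/
  zu : (d₂ W o₁ o₂ b₁ m).A.Avail K Γ false (W + 1)
  /-- `BZ` -/
  bz : (d₂ W o₁ o₂ b₁ m).B.Avail K Γ false (W + 2)
  /-- `VL` -/
  vl : (VL W o₁ o₂ b₁ b₂ m).Avail K Γ false (W + 2)
  /-- `TB` -/
  tb : (d₀ W o₁ o₂ o₃ m).D.Avail K Γ false (W + 1)
  /-- `Q₃` -/
  q3 : (d₃ W o₁ o₃ b₃ m).A.Avail K Γ false (W + 1)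
  /-- `VRp` -/
  vrp : (d₃ W o₁ o₃ b₃ m).B.Avail K Γ false (W + 2)
  /-- `TB'` -/
  tbp : (d₃ W o₁ o₃ b₃ m).D.Avail K Γ false (W + 2)
  /-- `VR` -/
  vr : (VR W o₁ o₃ o₄ b₃ b₄ m).Avail K Γ false (W + 2)

variable {W o₁ o₂ o₃ o₄ b₁ b₂ b₃ b₄ m}

/-- Availability of the main views is monotone. [folklore] -/
theorem MainViews.mono {K : PropForm ℕ} {Γ Γ' : Set (PropForm ℕ)} (h : MainViews W o₁ o₂ o₃ o₄ b₁ b₂ b₃ b₄ m K Γ) (hΓ : Γ ⊆ Γ') :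
    MainViews W o₁ o₂ o₃ o₄ b₁ b₂ b₃ b₄ m K Γ' :=
  ⟨h.ta.mono hΓ, h.b2.mono hΓ, h.zu.mono hΓ, h.bz.mono hΓ, h.vl.mono hΓ, h.tb.mono hΓ, h.q3.mono hΓ, h.vrp.mono hΓ, h.tbp.mono hΓ,
    h.vr.mono hΓ⟩

/-- **An available, correctly wired occurrence of the auxiliary template provides the main views.**
[folklore] -/
theorem mainAvail {K : PropForm ℕ} {Γ : Set (PropForm ℕ)} (hm : m.Avail (mainAuxT W) (12 * W + 12) K Γ)
    (hw : MWired W o₁ o₂ o₃ o₄ b₁ b₂ b₃ b₄ m) : MainViews W o₁ o₂ o₃ o₄ b₁ b₂ b₃ b₄ m K Γ := by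
  obtain ⟨h1, h2, h3, h4, h5, h6, h7, h8, h9, -⟩ := offsets W
  have hI : (m.inst (12 * W + 12)).DefsAvail (layout (pieces W) 10) K Γ := hm
  have href : ∀ i < 12 * W + 12, (m.inst (12 * W + 12)).ref (Sum.inl i) = m.inp i := fun i hi => m.ref_inl hi
  have rg : ∀ g, (m.inst (12 * W + 12)).ref (Sum.inr g) = m.base + g := fun g => rfl
  -- the recurring operand computations
  have eZ : ∀ j < W + 1, Z W o₁ o₂ j = if j < W then m.inp (W + j) else m.inp (8 * W + 4) := fun j hj => by
    rcases Nat.lt_succ_iff_lt_or_eq.1 hj with hj' | hj'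
    · rw [if_pos hj', Z, Adder.zext_lt _ _ hj', hw.hz j hj']
    · rw [if_neg (by omega), hj', Z, Adder.zext_top, hw.hf₁]
  have eX : ∀ j < W + 1, X W o₁ j = if j < W then m.inp j else m.inp (8 * W + 4) := fun j hj => by
    rcases Nat.lt_succ_iff_lt_or_eq.1 hj with hj' | hj'
    · rw [if_pos hj', X, Adder.zext_lt _ _ hj', hw.hx j hj']
    · rw [if_neg (by omega), hj', X, Adder.zext_top, hw.hf₁]
  have eN₁ : ∀ j < W + 2, Adder.zext (N₁ W o₁ b₁) (f W o₁) (W + 1) j = if j < W then m.inp (7 * W + 4 + j) else m.inp (8 * W + 4) :=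
    fun j hj => by
    by_cases hj' : j < W
    · rw [if_pos hj', Adder.zext_lt _ _ (by omega), N₁, Adder.zext_lt _ _ hj', hw.hM₁ j hj']
    · rw [if_neg hj', hw.hf₁]
      rcases Nat.lt_succ_iff_lt_or_eq.1 hj with hj'' | hj''
      · rw [Adder.zext_lt _ _ hj'', N₁, show j = W by omega, Adder.zext_top]
      · rw [hj'', Adder.zext_top]
  have eN₃ : ∀ j < W + 2, Adder.zext (N₃ W o₃ b₃) (f W o₁) (W + 1) j =
      if j < W then m.inp (10 * W + 9 + j) else if j = W then m.inp (11 * W + 9) else m.inp (8 * W + 4) := fun j hj => by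
    by_cases hj' : j < W
    · rw [if_pos hj', Adder.zext_lt _ _ (by omega), N₃, Adder.zext_lt _ _ hj', hw.hM₃ j hj']
    · rw [if_neg hj']
      rcases Nat.lt_succ_iff_lt_or_eq.1 hj with hj'' | hj''
      · rw [if_pos (by omega), Adder.zext_lt _ _ hj'', N₃, show j = W by omega, Adder.zext_top, hw.hf₃]
      · rw [if_neg (by omega), hj'', Adder.zext_top, hw.hf₁]
  refine ⟨?_, ?_, ?_, ?_, ?_, ?_, ?_, ?_, ?_, ?_⟩
  · -- `TA`, piece 0 at offset 0
    have h := Adder.avail_viewEmb (c₀ := false) (W := W + 1) (off := offset (pieces W) 0) (w := wTA W) hI fun k hk =>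
      getElem_layout (pieces W) (k := 0) (N := 10) (by omega) hk
    rw [offset_zero, Nat.add_zero] at h
    refine h.congr rfl (fun i hi => ?_) fun i hi => ?_
    · show Adder.extOut (d₀ W o₁ o₂ o₃ m).A W i = (m.inst (12 * W + 12)).ref (wTA W i)
      rw [wTA_x W hi, href _ (by omega), hw.hS₁ i hi]; rfl
    · show Adder.zext (fun i => o₂.inp (W + i)) (f W o₁) W i = (m.inst (12 * W + 12)).ref (wTA W (W + 1 + i))
      rcases Nat.lt_succ_iff_lt_or_eq.1 hi with hi' | hi'
      · rw [Adder.zext_lt _ _ hi', wTA_yl W hi', href _ (by omega), hw.hz i hi']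
      · rw [hi', Adder.zext_top, wTA_yh, href _ (by omega), hw.hf₁]
  · -- `B₂`, piece 1
    have h := Adder.avail_viewEmb (c₀ := false) (W := W + 2) (off := offset (pieces W) 1) (w := wB2 W) hI fun k hk =>
      getElem_layout (pieces W) (k := 1) (N := 10) (by omega) hk
    rw [h1] at h
    refine h.congr rfl (fun i hi => ?_) fun i hi => ?_
    · show Adder.zext (Z W o₁ o₂) (f W o₁) (W + 1) i = (m.inst (12 * W + 12)).ref (wB2 W i)
      by_cases hi' : i < W
      · rw [Adder.zext_lt _ _ (by omega), eZ i (by omega), if_pos hi', wB2_xl W hi', href _ (by omega)]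
      · rw [wB2_xh W (by omega) hi, href _ (by omega)]
        rcases Nat.lt_succ_iff_lt_or_eq.1 hi with hi'' | hi''
        · rw [Adder.zext_lt _ _ hi'', eZ i hi'', if_neg hi']
        · rw [hi'', Adder.zext_top, hw.hf₁]
    · show Adder.extOut (d₂ W o₁ o₂ b₁ m).C (W + 1) i = (m.inst (12 * W + 12)).ref (wB2 W (W + 2 + i))
      rw [wB2_y, href _ (by omega), hw.hP₁ i hi]; rfl
  · -- `ZU`, piece 2
    have h := Adder.avail_viewEmb (c₀ := false) (W := W + 1) (off := offset (pieces W) 2) (w := wZU W) hI fun k hk =>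
      getElem_layout (pieces W) (k := 2) (N := 10) (by omega) hk
    rw [h2] at h
    refine h.congr rfl (fun i hi => ?_) fun i hi => ?_
    · show Z W o₁ o₂ i = (m.inst (12 * W + 12)).ref (wZU W i)
      rcases Nat.lt_succ_iff_lt_or_eq.1 hi with hi' | hi'
      · rw [eZ i hi, if_pos hi', wZU_xl W hi', href _ (by omega)]
      · rw [eZ i hi, if_neg (by omega), hi', wZU_xh, href _ (by omega)]
    · show U₁ W o₁ i = (m.inst (12 * W + 12)).ref (wZU W (W + 1 + i))
      rcases Nat.lt_succ_iff_lt_or_eq.1 hi with hi' | hi'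
      · rw [U₁, Adder.zext_lt _ _ hi', wZU_yl W hi', href _ (by omega), hw.hu₁ i hi']
      · rw [hi', U₁, Adder.zext_top, wZU_yh, href _ (by omega), hw.hf₁]
  · -- `BZ`, piece 3
    have h := Adder.avail_viewEmb (c₀ := false) (W := W + 2) (off := offset (pieces W) 3) (w := wBZ W) hI fun k hk =>
      getElem_layout (pieces W) (k := 3) (N := 10) (by omega) hk
    rw [h3] at h
    refine h.congr rfl (fun i hi => ?_) fun i hi => ?_
    · show Adder.extOut (d₂ W o₁ o₂ b₁ m).A (W + 1) i = (m.inst (12 * W + 12)).ref (wBZ W i)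
      rcases Nat.lt_succ_iff_lt_or_eq.1 hi with hi' | hi'
      · rw [Adder.extOut_lt _ hi', wBZ_xl W hi', rg]; simp [d₂, Adder.AssocData.A, Adder.View.s, Adder.View.wire, Nat.add_assoc]
      · rw [hi', Adder.extOut_top, wBZ_xh, rg]; simp [d₂, Adder.AssocData.A, Adder.View.c, Adder.View.wire, Nat.add_assoc]
    · show Adder.zext (N₁ W o₁ b₁) (f W o₁) (W + 1) i = (m.inst (12 * W + 12)).ref (wBZ W (W + 2 + i))
      by_cases hi' : i < W
      · rw [eN₁ i hi, if_pos hi', wBZ_yl W hi', href _ (by omega)]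
      · rw [eN₁ i hi, if_neg hi', wBZ_yh W (by omega), href _ (by omega)]
  · -- `VL`, piece 4
    have h := Adder.avail_viewEmb (c₀ := false) (W := W + 2) (off := offset (pieces W) 4) (w := wVL W) hI fun k hk =>
      getElem_layout (pieces W) (k := 4) (N := 10) (by omega) hk
    rw [h4] at h
    refine h.congr rfl (fun i hi => ?_) fun i hi => ?_
    · show Adder.extOut (P W o₂ b₂) (W + 1) i = (m.inst (12 * W + 12)).ref (wVL W i)
      rw [wVL_x W hi, href _ (by omega), hw.hP₂ i hi]
    · show Adder.zext (N₁ W o₁ b₁) (f W o₁) (W + 1) i = (m.inst (12 * W + 12)).ref (wVL W (W + 2 + i))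
      by_cases hi' : i < W
      · rw [eN₁ i hi, if_pos hi', wVL_yl W hi', href _ (by omega)]
      · rw [eN₁ i hi, if_neg hi', wVL_yh W (by omega), href _ (by omega)]
  · -- `TB`, piece 5
    have h := Adder.avail_viewEmb (c₀ := false) (W := W + 1) (off := offset (pieces W) 5) (w := wTB W) hI fun k hk =>
      getElem_layout (pieces W) (k := 5) (N := 10) (by omega) hk
    rw [h5] at h
    refine h.congr rfl (fun i hi => ?_) fun i hi => ?_
    · show Adder.zext o₁.inp (f W o₁) W i = (m.inst (12 * W + 12)).ref (wTB W i)
      rcases Nat.lt_succ_iff_lt_or_eq.1 hi with hi' | hi'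
      · rw [Adder.zext_lt _ _ hi', wTB_xl W hi', href _ (by omega), hw.hx i hi']
      · rw [hi', Adder.zext_top, wTB_xh, href _ (by omega), hw.hf₁]
    · show Adder.extOut (d₀ W o₁ o₂ o₃ m).C W i = (m.inst (12 * W + 12)).ref (wTB W (W + 1 + i))
      rw [wTB_y, href _ (by omega), hw.hS₃ i hi]; rfl
  · -- `Q₃`, piece 6
    have h := Adder.avail_viewEmb (c₀ := false) (W := W + 1) (off := offset (pieces W) 6) (w := wQ3 W) hI fun k hk =>
      getElem_layout (pieces W) (k := 6) (N := 10) (by omega) hk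
    rw [h6] at h
    refine h.congr rfl (fun i hi => ?_) fun i hi => ?_
    · show X W o₁ i = (m.inst (12 * W + 12)).ref (wQ3 W i)
      rcases Nat.lt_succ_iff_lt_or_eq.1 hi with hi' | hi'
      · rw [eX i hi, if_pos hi', wQ3_xl W hi', href _ (by omega)]
      · rw [eX i hi, if_neg (by omega), hi', wQ3_xh, href _ (by omega)]
    · show U₃ W o₃ i = (m.inst (12 * W + 12)).ref (wQ3 W (W + 1 + i))
      rcases Nat.lt_succ_iff_lt_or_eq.1 hi with hi' | hi'
      · rw [U₃, Adder.zext_lt _ _ hi', wQ3_yl W hi', href _ (by omega), hw.hu₃ i hi']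
      · rw [hi', U₃, Adder.zext_top, wQ3_yh, href _ (by omega), hw.hf₃]
  · -- `VRp`, piece 7
    have h := Adder.avail_viewEmb (c₀ := false) (W := W + 2) (off := offset (pieces W) 7) (w := wVRp W) hI fun k hk =>
      getElem_layout (pieces W) (k := 7) (N := 10) (by omega) hk
    rw [h7] at h
    refine h.congr rfl (fun i hi => ?_) fun i hi => ?_
    · show Adder.extOut (d₃ W o₁ o₃ b₃ m).A (W + 1) i = (m.inst (12 * W + 12)).ref (wVRp W i)
      rcases Nat.lt_succ_iff_lt_or_eq.1 hi with hi' | hi'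
      · rw [Adder.extOut_lt _ hi', wVRp_xl W hi', rg]; simp [d₃, Adder.AssocData.A, Adder.View.s, Adder.View.wire, Nat.add_assoc]
      · rw [hi', Adder.extOut_top, wVRp_xh, rg]; simp [d₃, Adder.AssocData.A, Adder.View.c, Adder.View.wire, Nat.add_assoc]
    · show Adder.zext (N₃ W o₃ b₃) (f W o₁) (W + 1) i = (m.inst (12 * W + 12)).ref (wVRp W (W + 2 + i))
      by_cases hi' : i < W
      · rw [eN₃ i hi, if_pos hi', wVRp_yl W hi', href _ (by omega)]
      · rcases Nat.lt_succ_iff_lt_or_eq.1 hi with hi'' | hi''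
        · rw [eN₃ i hi, if_neg hi', if_pos (by omega), show i = W by omega, wVRp_ym, href _ (by omega)]
        · rw [eN₃ i hi, if_neg hi', if_neg (by omega), hi'', wVRp_yh, href _ (by omega)]
  · -- `TB'`, piece 8
    have h := Adder.avail_viewEmb (c₀ := false) (W := W + 2) (off := offset (pieces W) 8) (w := wTBp W) hI fun k hk =>
      getElem_layout (pieces W) (k := 8) (N := 10) (by omega) hk
    rw [h8] at h
    refine h.congr rfl (fun i hi => ?_) fun i hi => ?_
    · show Adder.zext (X W o₁) (f W o₁) (W + 1) i = (m.inst (12 * W + 12)).ref (wTBp W i)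
      by_cases hi' : i < W
      · rw [Adder.zext_lt _ _ (by omega), eX i (by omega), if_pos hi', wTBp_xl W hi', href _ (by omega)]
      · rw [wTBp_xh W (by omega) hi, href _ (by omega)]
        rcases Nat.lt_succ_iff_lt_or_eq.1 hi with hi'' | hi''
        · rw [Adder.zext_lt _ _ hi'', eX i hi'', if_neg hi']
        · rw [hi'', Adder.zext_top, hw.hf₁]
    · show Adder.extOut (d₃ W o₁ o₃ b₃ m).C (W + 1) i = (m.inst (12 * W + 12)).ref (wTBp W (W + 2 + i))
      rw [wTBp_y, href _ (by omega), hw.hP₃ i hi]; rfl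
  · -- `VR`, piece 9
    have h := Adder.avail_viewEmb (c₀ := false) (W := W + 2) (off := offset (pieces W) 9) (w := wVR W) hI fun k hk =>
      getElem_layout (pieces W) (k := 9) (N := 10) (by omega) hk
    rw [h9] at h
    refine h.congr rfl (fun i hi => ?_) fun i hi => ?_
    · show Adder.extOut (P W o₄ b₄) (W + 1) i = (m.inst (12 * W + 12)).ref (wVR W i)
      rw [wVR_x W hi, href _ (by omega), hw.hP₄ i hi]
    · show Adder.zext (N₃ W o₃ b₃) (f W o₁) (W + 1) i = (m.inst (12 * W + 12)).ref (wVR W (W + 2 + i))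
      by_cases hi' : i < W
      · rw [eN₃ i hi, if_pos hi', wVR_yl W hi', href _ (by omega)]
      · rcases Nat.lt_succ_iff_lt_or_eq.1 hi with hi'' | hi''
        · rw [eN₃ i hi, if_neg hi', if_pos (by omega), show i = W by omega, wVR_ym, href _ (by omega)]
        · rw [eN₃ i hi, if_neg hi', if_neg (by omega), hi'', wVR_yh, href _ (by omega)]

/-! ### Generic steps of the chains -/

section Steps

variable {G : FregeSystem} {K : PropForm ℕ} {Γ : Set (PropForm ℕ)}

/-- **An adder position over two false operand bits** (possibly different variables): the sum bit
equals the carry and no carry is produced. [cite: CookReckhow1979, §2] -/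
theorem topCC (hG : ARulesOK G) (V : Adder.View) {W : ℕ} (hV : V.Avail K Γ false (W + 1)) {a b : ℕ} (hxW : V.x W = a)
    (hyW : V.y W = b) (ha : ctx K (neg (var a)) ∈ Γ) (hb : ctx K (neg (var b)) ∈ Γ) :
    G.Yields Γ ({ctx K (eqv (V.s W) (V.c W))} ∪ {ctx K (neg (var (V.c (W + 1))))}) ((K.size + 10) + (K.size + 3)) := by
  have hs := (hV.2 W (Nat.lt_succ_self W)).1
  have hc := (hV.2 W (Nat.lt_succ_self W)).2
  rw [Adder.View.sumDef, hxW, hyW] at hs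
  rw [Adder.View.carryDef, hxW, hyW] at hc
  refine Yields.union ?_ ?_
  · have h := Yields.single (Assoc.infer hG 0 (by decide) (S := Γ) (FregeSystem.sub [K, var (V.s W), var a, var b, var (V.c W)])
      (θ := ctx K (eqv (V.s W) (V.c W))) rfl
      (FregeSystem.prems_cons hs (FregeSystem.prems_cons ha (FregeSystem.prems_cons hb FregeSystem.prems_nil))))
    exact h.mono_size (by simp [ctx, eqv, size, FregeSystem.size_biimp])
  · have h := Yields.single (Assoc.infer hG 1 (by decide) (S := Γ) (FregeSystem.sub [K, var (V.c (W + 1)), var a, var b, var (V.c W)])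
      (θ := ctx K (neg (var (V.c (W + 1))))) rfl
      (FregeSystem.prems_cons hc (FregeSystem.prems_cons ha (FregeSystem.prems_cons hb FregeSystem.prems_nil))))
    exact h.mono_size (by simp [ctx, size])

/-- A single transitivity inference. [cite: CookReckhow1979, §2] -/
theorem eqvTrans (hG : ARulesOK G) {x y z : ℕ} (h₁ : ctx K (eqv x y) ∈ Γ) (h₂ : ctx K (eqv y z) ∈ Γ) :
    G.Yields Γ {ctx K (eqv x z)} (K.size + 10) := by
  have h := Yields.single (Logic.infer hG.logic 6 (by decide) (S := Γ) (FregeSystem.sub [K, var x, var y, var z])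
    (θ := ctx K (eqv x z)) rfl (FregeSystem.prems_cons h₁ (FregeSystem.prems_cons h₂ FregeSystem.prems_nil)))
  exact h.mono_size (by simp [ctx, eqv, size, FregeSystem.size_biimp])

/-- A single symmetry inference. [cite: CookReckhow1979, §2] -/
theorem eqvSymm (hG : ARulesOK G) {x y : ℕ} (h : ctx K (eqv x y) ∈ Γ) : G.Yields Γ {ctx K (eqv y x)} (K.size + 10) := by
  have h' := Yields.single (Logic.infer hG.logic 5 (by decide) (S := Γ) (FregeSystem.sub [K, var x, var y])
    (θ := ctx K (eqv y x)) rfl (FregeSystem.prems_cons h FregeSystem.prems_nil))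
  exact h'.mono_size (by simp [ctx, eqv, size, FregeSystem.size_biimp])

/-- Two false bits are equal (single inference). [cite: CookReckhow1979, §2] -/
theorem eqvFF (hG : ARulesOK G) {x y : ℕ} (h₁ : ctx K (neg (var x)) ∈ Γ) (h₂ : ctx K (neg (var y)) ∈ Γ) :
    G.Yields Γ {ctx K (eqv x y)} (K.size + 10) := by
  have h := Yields.single (Logic.infer hG.logic 10 (by decide) (S := Γ) (FregeSystem.sub [K, var x, var y])
    (θ := ctx K (eqv x y)) rfl (FregeSystem.prems_cons h₁ (FregeSystem.prems_cons h₂ FregeSystem.prems_nil)))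
  exact h.mono_size (by simp [ctx, eqv, size, FregeSystem.size_biimp])

variable {W : ℕ}

/-- The glue lines of a `(W+1)`-bit adder `Q` with the split adder of an occurrence: sum bits and the
two (false) carries. [folklore] -/
def glueBodies (W : ℕ) (Q : Adder.View) (o b : Occ) : List (PropForm ℕ) :=
  (List.range (W + 1)).map (fun i => eqv (Q.s i) ((P W o b).s i)) ++ [eqv (Q.c (W + 1)) ((P W o b).c (W + 1))]

/-- The glue lines give the equality of the extended output words. [folklore] -/
theorem holds_ext_of_glue {Q : Adder.View} {o b : Occ} (h : Holds K Γ (glueBodies W Q o b)) :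
    Holds K Γ (eqW (Adder.extOut Q (W + 1)) (Adder.extOut (P W o b) (W + 1)) (W + 2)) := by
  refine holds_eqW_iff.2 fun i hi => ?_
  rcases Nat.lt_succ_iff_lt_or_eq.1 hi with hi' | hi'
  · rw [Adder.extOut_lt _ hi', Adder.extOut_lt _ hi']
    exact h _ (List.mem_append_left _ (List.mem_map.2 ⟨i, List.mem_range.2 hi', rfl⟩))
  · rw [hi', Adder.extOut_top, Adder.extOut_top]
    exact h _ (List.mem_append_right _ (List.mem_singleton_self _))

/-- **Glue**: a `(W+1)`-bit adder `Q` that agrees with the adder of the occurrence `o` on all `2W+1`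
wires, whose top position lies over two false bits (`s_W(Q) ↔ c_W(Q)`, `¬c_{W+1}(Q)`), together with
the split identity of `o`, gives `extOut Q = extOut P` for the split adder `P` of `o`.
[cite: CookReckhow1979, §2] -/
theorem glue (hG : ARulesOK G) (Q : Adder.View) (o b : Occ) (hw : ∀ k < 2 * W + 1, ctx K (eqv (Q.wire k) ((A W o).wire k)) ∈ Γ)
    (htop : ctx K (eqv (Q.s W) (Q.c W)) ∈ Γ) (hnc : ctx K (neg (var (Q.c (W + 1)))) ∈ Γ) (hsp : Holds K Γ (splitBodies W o b)) :
    G.Yields Γ (ctxSet K (glueBodies W Q o b)) ((2 * W + 6) * (K.size + 10)) := by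
  -- t1: the split sum lines, reversed
  have t1 : G.Yields Γ (ctxSet K (eqW (Adder.extOut (A W o) W) (P W o b).s (W + 1))) ((W + 1) * (K.size + 10)) :=
    Yields.eqW_symm hG.logic (holds_eqW_iff.2 fun i hi => hsp _ (List.mem_append_left _ (mem_eqW (a := (P W o b).s) hi)))
  set A1 := ctxSet K (eqW (Adder.extOut (A W o) W) (P W o b).s (W + 1)) with hA1
  have m1 : ∀ i < W, ctx K (eqv ((A W o).s i) ((P W o b).s i)) ∈ Γ ∪ A1 := fun i hi => by
    have h : ctx K (eqv (Adder.extOut (A W o) W i) ((P W o b).s i)) ∈ A1 := mem_ctxSet (mem_eqW (a := Adder.extOut (A W o) W) (by omega))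
    rw [Adder.extOut_lt _ hi] at h; exact Or.inr h
  have m1W : ctx K (eqv ((A W o).c W) ((P W o b).s W)) ∈ Γ ∪ A1 := by
    have h : ctx K (eqv (Adder.extOut (A W o) W W) ((P W o b).s W)) ∈ A1 := mem_ctxSet (mem_eqW (a := Adder.extOut (A W o) W) (by omega))
    rw [Adder.extOut_top] at h; exact Or.inr h
  -- t2: the sum bits below `W`
  have t2 : G.Yields (Γ ∪ A1) (ctxSet K ((List.range W).map fun i => eqv (Q.s i) ((P W o b).s i))) (W * (K.size + 9 + 1)) :=
    Yields.ctx_range (fun i hi => Or.inr (Logic.infer hG.logic 6 (by decide) (FregeSystem.sub [K, var (Q.s i), var ((A W o).s i), var ((P W o b).s i)])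
      rfl (FregeSystem.prems_cons (Or.inl (hw (2 * i + 1) (by omega))) (FregeSystem.prems_cons (m1 i hi) FregeSystem.prems_nil))))
      fun _ _ => (size_eqv _ _).le
  set A2 := A1 ∪ ctxSet K ((List.range W).map fun i => eqv (Q.s i) ((P W o b).s i)) with hA2
  -- t3: position `W`: `s_W(Q) ↔ c_W(Q) ↔ c_W(A) ↔ s_W(P)`
  have t3 := (eqvTrans hG (K := K) (Γ := Γ ∪ A2) (Or.inl htop) (Or.inl (hw (2 * W) (by omega)))).trans
    (eqvTrans hG (x := Q.s W) (y := (A W o).c W) (z := (P W o b).s W) (Or.inr rfl) (Or.inl (m1W.elim Or.inl fun h => Or.inr (Or.inl h))))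
  set A3 := A2 ∪ ({ctx K (eqv (Q.s W) ((A W o).c W))} ∪ {ctx K (eqv (Q.s W) ((P W o b).s W))}) with hA3
  -- t4: the carries are both false
  have t4 : G.Yields (Γ ∪ A3) {ctx K (eqv (Q.c (W + 1)) ((P W o b).c (W + 1)))} (K.size + 10) :=
    eqvFF hG (Or.inl hnc) (Or.inl (hsp _ (List.mem_append_right _ (List.mem_singleton_self _))))
  have h := ((t1.trans t2).trans t3).trans t4
  refine (h.mono_right ?_).mono_size (by nlinarith)
  rintro θ ⟨L, hL, rfl⟩
  rcases List.mem_append.1 hL with hL | hL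
  · obtain ⟨i, hi, rfl⟩ := List.mem_map.1 hL
    rcases Nat.lt_succ_iff_lt_or_eq.1 (List.mem_range.1 hi) with hi' | hi'
    · exact Or.inl (Or.inl (Or.inr (mem_ctxSet (List.mem_map.2 ⟨i, List.mem_range.2 hi', rfl⟩))))
    · rw [hi']; exact Or.inl (Or.inr (Or.inr rfl))
  · rw [List.mem_singleton.1 hL]; exact Or.inr rfl

end Steps

/-! ### The left chain: `VL = (Z + U₁) + N₁ = Z + (U₁ + N₁) = (x + y) + z` -/

section Left

variable {G : FregeSystem} {K : PropForm ℕ} {Γ : Set (PropForm ℕ)} {W : ℕ} {o₁ o₂ o₃ o₄ b₁ b₂ b₃ b₄ m : Occ}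

/-- The lines of the left chain: `s_i(VL) ↔ (extOut TA)_i`, in the form `s`/`c`. [folklore] -/
def leftBodies (W : ℕ) (o₁ o₂ o₃ b₁ b₂ m : Occ) : List (PropForm ℕ) :=
  (List.range (W + 1)).map (fun i => eqv ((VL W o₁ o₂ b₁ b₂ m).s i) ((d₀ W o₁ o₂ o₃ m).B.s i)) ++
    [eqv ((VL W o₁ o₂ b₁ b₂ m).s (W + 1)) ((d₀ W o₁ o₂ o₃ m).B.c (W + 1))]

/-- The left lines give `s(VL) = extOut TA` as words. [folklore] -/
theorem holds_left {o₁ o₂ o₃ b₁ b₂ m : Occ} (h : Holds K Γ (leftBodies W o₁ o₂ o₃ b₁ b₂ m)) :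
    Holds K Γ (eqW (VL W o₁ o₂ b₁ b₂ m).s (Adder.extOut (d₀ W o₁ o₂ o₃ m).B (W + 1)) (W + 2)) := by
  refine holds_eqW_iff.2 fun i hi => ?_
  rcases Nat.lt_succ_iff_lt_or_eq.1 hi with hi' | hi'
  · rw [Adder.extOut_lt _ hi']; exact h _ (List.mem_append_left _ (List.mem_map.2 ⟨i, List.mem_range.2 hi', rfl⟩))
  · rw [hi', Adder.extOut_top]; exact h _ (List.mem_append_right _ (List.mem_singleton_self _))

/-- **The left chain.** From the views of `o₁, o₂`, their split identities, the split adder of `o₁`,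
the main views and the literal of the `⊥` gate of `o₁`: the sum bits of `VL` are provably those of
`extOut TA = (x + y) + z`. [cite: CookReckhow1979, §2] [cite: Krajicek1995, §9.2] -/
theorem leftChain (hG : ARulesOK G) (v₂ : Views W o₂ K Γ) (sv₁ : SplitViews W o₁ b₁ K Γ)
    (mv : MainViews W o₁ o₂ o₃ o₄ b₁ b₂ b₃ b₄ m K Γ) (hsp₁ : Holds K Γ (splitBodies W o₁ b₁)) (hsp₂ : Holds K Γ (splitBodies W o₂ b₂))
    (hf₁ : ctx K (neg (var (f W o₁))) ∈ Γ) (h₂x : ∀ i < W, o₂.inp i = u W o₁ i) :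
    G.Yields Γ (ctxSet K (leftBodies W o₁ o₂ o₃ b₁ b₂ m)) ((30 * W + 60) * (K.size + 60)) := by
  -- s1: reflexivity lines
  have s1 := (((Yields.eqW_refl hG.adder K (Z W o₁ o₂) (W + 1) (Γ := Γ)).union
    (Yields.eqW_refl hG.adder K (Adder.zext (N₁ W o₁ b₁) (f W o₁) (W + 1)) (W + 2))).union
    (Yields.eqW_refl hG.adder K (fun i => o₂.inp (W + i)) W)).union (Yields.eqW_refl hG.adder K (u W o₁) W)
  set A1 : Set (PropForm ℕ) := ((ctxSet K (eqW (Z W o₁ o₂) (Z W o₁ o₂) (W + 1)) ∪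
    ctxSet K (eqW (Adder.zext (N₁ W o₁ b₁) (f W o₁) (W + 1)) (Adder.zext (N₁ W o₁ b₁) (f W o₁) (W + 1)) (W + 2))) ∪
    ctxSet K (eqW (fun i => o₂.inp (W + i)) (fun i => o₂.inp (W + i)) W)) ∪ ctxSet K (eqW (u W o₁) (u W o₁) W) with hA1
  have rZ : ∀ i < W + 1, ctx K (eqv (Z W o₁ o₂ i) (Z W o₁ o₂ i)) ∈ A1 := fun i hi => Or.inl (Or.inl (Or.inl (mem_ctxSet (mem_eqW hi))))
  have rN : ∀ i < W + 2, ctx K (eqv (Adder.zext (N₁ W o₁ b₁) (f W o₁) (W + 1) i) (Adder.zext (N₁ W o₁ b₁) (f W o₁) (W + 1) i)) ∈ A1 :=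
    fun i hi => Or.inl (Or.inl (Or.inr (mem_ctxSet (mem_eqW hi))))
  have rz : ∀ i < W, ctx K (eqv (o₂.inp (W + i)) (o₂.inp (W + i))) ∈ A1 := fun i hi =>
    Or.inl (Or.inr (mem_ctxSet (mem_eqW (a := fun i => o₂.inp (W + i)) hi)))
  have ru : ∀ i < W, ctx K (eqv (u W o₁ i) (u W o₁ i)) ∈ A1 := fun i hi => Or.inr (mem_ctxSet (mem_eqW hi))
  -- s2: the split sum lines of `o₁`, reversed
  have s2 : G.Yields (Γ ∪ A1) (ctxSet K (eqW (Adder.extOut (A W o₁) W) (P W o₁ b₁).s (W + 1))) ((W + 1) * (K.size + 10)) :=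
    Yields.eqW_symm hG.logic (holds_eqW_iff.2 fun i hi => Or.inl (hsp₁ _ (List.mem_append_left _ (mem_eqW (a := (P W o₁ b₁).s) hi))))
  set A2 := A1 ∪ ctxSet K (eqW (Adder.extOut (A W o₁) W) (P W o₁ b₁).s (W + 1)) with hA2
  -- s3: `TA = S₁ + Z` and `B₂ = zext Z + extOut P₁` agree on the low `2(W+1)+1` wires (commutativity)
  have s3 : G.Yields (Γ ∪ A2) {χ | χ ∈ Adder.commLines (d₀ W o₁ o₂ o₃ m).B (d₂ W o₁ o₂ b₁ m).D K (W + 1)} ((2 * (W + 1) + 1) * (K.size + 10)) := by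
    refine Yields.of_isBlock (Adder.isBlock_commLines hG.netlist hG.adder (d₀ W o₁ o₂ o₃ m).B (d₂ W o₁ o₂ b₁ m).D
      (mv.ta.mono Set.subset_union_left) ((mv.b2.of_le (Nat.le_succ _)).mono Set.subset_union_left) (fun i hi => ?_) fun i hi => ?_)
      subset_rfl (Adder.proofSize_commLines _ _ _ _)
    · show ctx K (eqv (Adder.extOut (A W o₁) W i) (Adder.extOut (P W o₁ b₁) (W + 1) i)) ∈ Γ ∪ A2
      rw [Adder.extOut_lt (P W o₁ b₁) hi]; exact Or.inr (Or.inr (mem_ctxSet (mem_eqW (a := Adder.extOut (A W o₁) W) hi)))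
    · show ctx K (eqv (Z W o₁ o₂ i) (Adder.zext (Z W o₁ o₂) (f W o₁) (W + 1) i)) ∈ Γ ∪ A2
      rw [Adder.zext_lt _ _ hi]; exact Or.inr (Or.inl (rZ i hi))
  set A3 := A2 ∪ {χ | χ ∈ Adder.commLines (d₀ W o₁ o₂ o₃ m).B (d₂ W o₁ o₂ b₁ m).D K (W + 1)} with hA3
  have m3 : ∀ k < 2 * (W + 1) + 1, ctx K (eqv ((d₀ W o₁ o₂ o₃ m).B.wire k) ((d₂ W o₁ o₂ b₁ m).D.wire k)) ∈ A3 := fun k hk =>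
    Or.inr (Adder.mem_commLines hk)
  -- s4: the top position of `B₂`
  have s4 : G.Yields (Γ ∪ A3) ({ctx K (eqv ((d₂ W o₁ o₂ b₁ m).D.s (W + 1)) ((d₂ W o₁ o₂ b₁ m).D.c (W + 1)))} ∪
      {ctx K (neg (var ((d₂ W o₁ o₂ b₁ m).D.c (W + 1 + 1))))}) ((K.size + 10) + (K.size + 3)) :=
    topCC hG (d₂ W o₁ o₂ b₁ m).D (mv.b2.mono Set.subset_union_left) (show Adder.zext (Z W o₁ o₂) (f W o₁) (W + 1) (W + 1) = f W o₁ from Adder.zext_top _ _ _)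
      (show Adder.extOut (P W o₁ b₁) (W + 1) (W + 1) = (P W o₁ b₁).c (W + 1) from Adder.extOut_top _ _)
      (Or.inl hf₁) (Or.inl (hsp₁ _ (List.mem_append_right _ (List.mem_singleton_self _))))
  set A4 := A3 ∪ ({ctx K (eqv ((d₂ W o₁ o₂ b₁ m).D.s (W + 1)) ((d₂ W o₁ o₂ b₁ m).D.c (W + 1)))} ∪
    {ctx K (neg (var ((d₂ W o₁ o₂ b₁ m).D.c (W + 1 + 1))))}) with hA4
  -- s5: `c_{W+1}(TA) ↔ s_{W+1}(B₂)`
  have s5 := (eqvSymm hG (K := K) (Γ := Γ ∪ A4) (x := (d₂ W o₁ o₂ b₁ m).D.s (W + 1)) (y := (d₂ W o₁ o₂ b₁ m).D.c (W + 1))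
    (Or.inr (Or.inr (Or.inl rfl)))).trans
    (eqvTrans hG (x := (d₀ W o₁ o₂ o₃ m).B.c (W + 1)) (y := (d₂ W o₁ o₂ b₁ m).D.c (W + 1)) (z := (d₂ W o₁ o₂ b₁ m).D.s (W + 1))
      (Or.inl (Or.inr (Or.inl (m3 (2 * (W + 1)) (by omega))))) (Or.inr rfl))
  set A5 := A4 ∪ ({ctx K (eqv ((d₂ W o₁ o₂ b₁ m).D.c (W + 1)) ((d₂ W o₁ o₂ b₁ m).D.s (W + 1)))} ∪
    {ctx K (eqv ((d₀ W o₁ o₂ o₃ m).B.c (W + 1)) ((d₂ W o₁ o₂ b₁ m).D.s (W + 1)))}) with hA5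
  -- s6: associativity `(Z + U₁) + N₁ = Z + (U₁ + N₁)`: `s(BZ) = s(B₂)`
  have s6 : G.Yields (Γ ∪ A5) {χ | χ ∈ (d₂ W o₁ o₂ b₁ m).lines K} ((2 * (W + 1) + 3) * (K.size + 60)) :=
    Yields.of_isBlock (Adder.AssocData.isBlock_lines hG.adderLaw (d₂ W o₁ o₂ b₁ m) (mv.zu.mono Set.subset_union_left)
      (mv.bz.mono Set.subset_union_left) (sv₁.adder.mono Set.subset_union_left) (mv.b2.mono Set.subset_union_left) (Or.inl hf₁))
      subset_rfl (Adder.AssocData.proofSize_lines _ _)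
  set A6 := A5 ∪ {χ | χ ∈ (d₂ W o₁ o₂ b₁ m).lines K} with hA6
  -- s7: `ZU = Z + U₁` and `u₁ + z` agree on the low `2W+1` wires (commutativity)
  have s7 : G.Yields (Γ ∪ A6) {χ | χ ∈ Adder.commLines (d₂ W o₁ o₂ b₁ m).A (A W o₂) K W} ((2 * W + 1) * (K.size + 10)) := by
    refine Yields.of_isBlock (Adder.isBlock_commLines hG.netlist hG.adder (d₂ W o₁ o₂ b₁ m).A (A W o₂)
      ((mv.zu.of_le (Nat.le_succ W)).mono Set.subset_union_left) (v₂.adder.mono Set.subset_union_left) (fun i hi => ?_) fun i hi => ?_)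
      subset_rfl (Adder.proofSize_commLines _ _ _ _)
    · show ctx K (eqv (Z W o₁ o₂ i) (o₂.inp (W + i))) ∈ Γ ∪ A6
      rw [Z, Adder.zext_lt _ _ hi]; exact Or.inr (Or.inl (Or.inl (Or.inl (Or.inl (Or.inl (rz i hi))))))
    · show ctx K (eqv (U₁ W o₁ i) (o₂.inp i)) ∈ Γ ∪ A6
      rw [U₁, Adder.zext_lt _ _ hi, h₂x i hi]; exact Or.inr (Or.inl (Or.inl (Or.inl (Or.inl (Or.inl (ru i hi))))))
  set A7 := A6 ∪ {χ | χ ∈ Adder.commLines (d₂ W o₁ o₂ b₁ m).A (A W o₂) K W} with hA7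
  -- s8: the top position of `ZU`
  have s8 : G.Yields (Γ ∪ A7) ({ctx K (eqv ((d₂ W o₁ o₂ b₁ m).A.s W) ((d₂ W o₁ o₂ b₁ m).A.c W))} ∪
      {ctx K (neg (var ((d₂ W o₁ o₂ b₁ m).A.c (W + 1))))}) ((K.size + 10) + (K.size + 3)) :=
    topCC hG (d₂ W o₁ o₂ b₁ m).A (mv.zu.mono Set.subset_union_left) (show Z W o₁ o₂ W = f W o₁ from Adder.zext_top _ _ _)
      (show U₁ W o₁ W = f W o₁ from Adder.zext_top _ _ _) (Or.inl hf₁) (Or.inl hf₁)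
  set A8 := A7 ∪ ({ctx K (eqv ((d₂ W o₁ o₂ b₁ m).A.s W) ((d₂ W o₁ o₂ b₁ m).A.c W))} ∪
    {ctx K (neg (var ((d₂ W o₁ o₂ b₁ m).A.c (W + 1))))}) with hA8
  -- s9: glue `extOut ZU = extOut P₂`
  have s9 : G.Yields (Γ ∪ A8) (ctxSet K (glueBodies W (d₂ W o₁ o₂ b₁ m).A o₂ b₂)) ((2 * W + 6) * (K.size + 10)) :=
    glue hG (d₂ W o₁ o₂ b₁ m).A o₂ b₂ (fun k hk => Or.inr (Or.inl (Or.inr (Adder.mem_commLines hk)))) (Or.inr (Or.inr (Or.inl rfl)))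
      (Or.inr (Or.inr (Or.inr rfl))) (hsp₂.mono Set.subset_union_left)
  set A9 := A8 ∪ ctxSet K (glueBodies W (d₂ W o₁ o₂ b₁ m).A o₂ b₂) with hA9
  -- s10: congruence `BZ = VL`
  have s10 : G.Yields (Γ ∪ A9) {χ | χ ∈ Adder.leibLines (d₂ W o₁ o₂ b₁ m).B (VL W o₁ o₂ b₁ b₂ m) K (W + 2)} ((2 * (W + 2) + 1) * (K.size + 10)) := by
    have hg := holds_ext_of_glue (holds_ctxSet (Set.subset_union_right.trans (Set.subset_union_right (s := Γ))) :
      Holds K (Γ ∪ A9) (glueBodies W (d₂ W o₁ o₂ b₁ m).A o₂ b₂))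
    refine Yields.of_isBlock (Adder.isBlock_leibLines hG.netlist (d₂ W o₁ o₂ b₁ m).B (VL W o₁ o₂ b₁ b₂ m) (mv.bz.mono Set.subset_union_left)
      (mv.vl.mono Set.subset_union_left) (fun i hi => holds_eqW_iff.1 hg i hi) fun i hi => ?_) subset_rfl (Adder.proofSize_leibLines _ _ _ _)
    exact Or.inr (Or.inl (Or.inl (Or.inl (Or.inl (Or.inl (Or.inl (Or.inl (Or.inl (rN i hi)))))))))
  set A10 := A9 ∪ {χ | χ ∈ Adder.leibLines (d₂ W o₁ o₂ b₁ m).B (VL W o₁ o₂ b₁ b₂ m) K (W + 2)} with hA10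
  -- s11: `s(VL) = s(BZ)`, `s(VL) = s(B₂)`
  have s11a : G.Yields (Γ ∪ A10) (ctxSet K (eqW (VL W o₁ o₂ b₁ b₂ m).s (d₂ W o₁ o₂ b₁ m).B.s (W + 2))) ((W + 2) * (K.size + 10)) :=
    Yields.eqW_symm hG.logic (holds_eqW_iff.2 fun i hi => Or.inr (Or.inr (Adder.mem_leibLines (k := 2 * i + 1) (by omega))))
  set A11 := A10 ∪ ctxSet K (eqW (VL W o₁ o₂ b₁ b₂ m).s (d₂ W o₁ o₂ b₁ m).B.s (W + 2)) with hA11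
  have s11b : G.Yields (Γ ∪ A11) (ctxSet K (eqW (VL W o₁ o₂ b₁ b₂ m).s (d₂ W o₁ o₂ b₁ m).D.s (W + 2))) ((W + 2) * (K.size + 10)) :=
    Yields.eqW_trans hG.logic (b := (d₂ W o₁ o₂ b₁ m).B.s) (holds_eqW_iff.2 fun i hi => Or.inr (Or.inr (mem_ctxSet (mem_eqW hi))))
      (holds_eqW_iff.2 fun i hi => Or.inr (Or.inl (Or.inl (Or.inl (Or.inl (Or.inl (Or.inr ((d₂ W o₁ o₂ b₁ m).sum_mem_lines K (by show i ≤ W + 1; omega)))))))))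
  set A12 := A11 ∪ ctxSet K (eqW (VL W o₁ o₂ b₁ b₂ m).s (d₂ W o₁ o₂ b₁ m).D.s (W + 2)) with hA12
  -- s12: `s(B₂) = extOut TA`, reversed from s3/s5, then the final transitivity
  have s12a : G.Yields (Γ ∪ A12) (ctxSet K ((List.range (W + 1)).map fun i => eqv ((d₂ W o₁ o₂ b₁ m).D.s i) ((d₀ W o₁ o₂ o₃ m).B.s i)))
      ((W + 1) * (K.size + 9 + 1)) :=
    Yields.ctx_range
      (fun i hi => Or.inr (Logic.infer hG.logic 5 (by decide)
        (FregeSystem.sub [K, var ((d₀ W o₁ o₂ o₃ m).B.s i), var ((d₂ W o₁ o₂ b₁ m).D.s i)]) rfl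
        (FregeSystem.prems_cons
          (Or.inr (Or.inl (Or.inl (Or.inl (Or.inl (Or.inl (Or.inl (Or.inl (Or.inl (Or.inl (m3 (2 * i + 1) (by omega))))))))))))
          FregeSystem.prems_nil)))
      fun _ _ => (size_eqv _ _).le
  set A13 := A12 ∪ ctxSet K ((List.range (W + 1)).map fun i => eqv ((d₂ W o₁ o₂ b₁ m).D.s i) ((d₀ W o₁ o₂ o₃ m).B.s i)) with hA13
  have s12b : G.Yields (Γ ∪ A13) {ctx K (eqv ((d₂ W o₁ o₂ b₁ m).D.s (W + 1)) ((d₀ W o₁ o₂ o₃ m).B.c (W + 1)))} (K.size + 10) :=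
    eqvSymm hG (Or.inr (Or.inl (Or.inl (Or.inl (Or.inl (Or.inl (Or.inl (Or.inl (Or.inl (Or.inr (Or.inr rfl)))))))))))
  set A14 := A13 ∪ {ctx K (eqv ((d₂ W o₁ o₂ b₁ m).D.s (W + 1)) ((d₀ W o₁ o₂ o₃ m).B.c (W + 1)))} with hA14
  have s12c : G.Yields (Γ ∪ A14) (ctxSet K ((List.range (W + 1)).map fun i => eqv ((VL W o₁ o₂ b₁ b₂ m).s i) ((d₀ W o₁ o₂ o₃ m).B.s i)))
      ((W + 1) * (K.size + 9 + 1)) :=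
    Yields.ctx_range
      (fun i hi => Or.inr (Logic.infer hG.logic 6 (by decide)
        (FregeSystem.sub [K, var ((VL W o₁ o₂ b₁ b₂ m).s i), var ((d₂ W o₁ o₂ b₁ m).D.s i), var ((d₀ W o₁ o₂ o₃ m).B.s i)]) rfl
        (FregeSystem.prems_cons
          (Or.inr (Or.inl (Or.inl (Or.inr (mem_ctxSet (mem_eqW (a := (VL W o₁ o₂ b₁ b₂ m).s) (by omega)))))))
          (FregeSystem.prems_cons
            (Or.inr (Or.inl (Or.inr (mem_ctxSet (List.mem_map.2 ⟨i, List.mem_range.2 hi, rfl⟩)))))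
            FregeSystem.prems_nil))))
      fun _ _ => (size_eqv _ _).le
  set A15 := A14 ∪ ctxSet K ((List.range (W + 1)).map fun i => eqv ((VL W o₁ o₂ b₁ b₂ m).s i) ((d₀ W o₁ o₂ o₃ m).B.s i)) with hA15
  have s12d : G.Yields (Γ ∪ A15) {ctx K (eqv ((VL W o₁ o₂ b₁ b₂ m).s (W + 1)) ((d₀ W o₁ o₂ o₃ m).B.c (W + 1)))} (K.size + 10) :=
    eqvTrans hG (y := (d₂ W o₁ o₂ b₁ m).D.s (W + 1))
      (Or.inr (Or.inl (Or.inl (Or.inl (Or.inr (mem_ctxSet (mem_eqW (a := (VL W o₁ o₂ b₁ b₂ m).s) (by omega))))))))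
      (Or.inr (Or.inl (Or.inr rfl)))
  have h := ((((((((((((((s1.trans s2).trans s3).trans s4).trans s5).trans s6).trans s7).trans s8).trans s9).trans s10).trans
    s11a).trans s11b).trans s12a).trans s12b).trans s12c).trans s12d
  refine (h.mono_right ?_).mono_size (by nlinarith [Nat.zero_le W, Nat.zero_le K.size])
  rintro θ ⟨L, hL, rfl⟩
  rcases List.mem_append.1 hL with hL | hL
  · exact Or.inl (Or.inr (mem_ctxSet hL))
  · rw [List.mem_singleton.1 hL]; exact Or.inr rfl

end Left

/-! ### The right chain: `VR = (X + U₃) + N₃ = X + (U₃ + N₃) = x + (y + z)` -/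

section Right

variable {G : FregeSystem} {K : PropForm ℕ} {Γ : Set (PropForm ℕ)} {W : ℕ} {o₁ o₂ o₃ o₄ b₁ b₂ b₃ b₄ m : Occ}

/-- The lines of the right chain: `s_i(VR) ↔ (extOut TB)_i`, in the form `s`/`c`. [folklore] -/
def rightBodies (W : ℕ) (o₁ o₂ o₃ o₄ b₃ b₄ m : Occ) : List (PropForm ℕ) :=
  (List.range (W + 1)).map (fun i => eqv ((VR W o₁ o₃ o₄ b₃ b₄ m).s i) ((d₀ W o₁ o₂ o₃ m).D.s i)) ++
    [eqv ((VR W o₁ o₃ o₄ b₃ b₄ m).s (W + 1)) ((d₀ W o₁ o₂ o₃ m).D.c (W + 1))]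

/-- **The right chain.** [cite: CookReckhow1979, §2] [cite: Krajicek1995, §9.2] -/
theorem rightChain (hG : ARulesOK G) (v₄ : Views W o₄ K Γ) (sv₃ : SplitViews W o₃ b₃ K Γ)
    (mv : MainViews W o₁ o₂ o₃ o₄ b₁ b₂ b₃ b₄ m K Γ) (hsp₃ : Holds K Γ (splitBodies W o₃ b₃)) (hsp₄ : Holds K Γ (splitBodies W o₄ b₄))
    (hf₁ : ctx K (neg (var (f W o₁))) ∈ Γ) (hf₃ : ctx K (neg (var (f W o₃))) ∈ Γ)
    (h₄x : ∀ i < W, o₄.inp i = o₁.inp i) (h₄y : ∀ i < W, o₄.inp (W + i) = u W o₃ i) :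
    G.Yields Γ (ctxSet K (rightBodies W o₁ o₂ o₃ o₄ b₃ b₄ m)) ((30 * W + 60) * (K.size + 60)) := by
  -- r1: reflexivity lines
  have r1 := (((Yields.eqW_refl hG.adder K (X W o₁) (W + 1) (Γ := Γ)).union
    (Yields.eqW_refl hG.adder K (Adder.zext (N₃ W o₃ b₃) (f W o₁) (W + 1)) (W + 2))).union
    (Yields.eqW_refl hG.adder K o₁.inp W)).union (Yields.eqW_refl hG.adder K (u W o₃) W)
  set A1 : Set (PropForm ℕ) := ((ctxSet K (eqW (X W o₁) (X W o₁) (W + 1)) ∪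
    ctxSet K (eqW (Adder.zext (N₃ W o₃ b₃) (f W o₁) (W + 1)) (Adder.zext (N₃ W o₃ b₃) (f W o₁) (W + 1)) (W + 2))) ∪
    ctxSet K (eqW o₁.inp o₁.inp W)) ∪ ctxSet K (eqW (u W o₃) (u W o₃) W) with hA1
  have rX : ∀ i < W + 1, ctx K (eqv (X W o₁ i) (X W o₁ i)) ∈ A1 := fun i hi => Or.inl (Or.inl (Or.inl (mem_ctxSet (mem_eqW hi))))
  have rN : ∀ i < W + 2, ctx K (eqv (Adder.zext (N₃ W o₃ b₃) (f W o₁) (W + 1) i) (Adder.zext (N₃ W o₃ b₃) (f W o₁) (W + 1) i)) ∈ A1 :=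
    fun i hi => Or.inl (Or.inl (Or.inr (mem_ctxSet (mem_eqW hi))))
  have rx : ∀ i < W, ctx K (eqv (o₁.inp i) (o₁.inp i)) ∈ A1 := fun i hi => Or.inl (Or.inr (mem_ctxSet (mem_eqW hi)))
  have ru : ∀ i < W, ctx K (eqv (u W o₃ i) (u W o₃ i)) ∈ A1 := fun i hi => Or.inr (mem_ctxSet (mem_eqW hi))
  -- r2: `TB'` and `TB` agree on the low `2(W+1)+1` wires (congruence with the split identity of `o₃`)
  have r2 : G.Yields (Γ ∪ A1) {χ | χ ∈ Adder.leibLines (d₃ W o₁ o₃ b₃ m).D (d₀ W o₁ o₂ o₃ m).D K (W + 1)} ((2 * (W + 1) + 1) * (K.size + 10)) := by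
    refine Yields.of_isBlock (Adder.isBlock_leibLines hG.netlist (d₃ W o₁ o₃ b₃ m).D (d₀ W o₁ o₂ o₃ m).D
      ((mv.tbp.of_le (Nat.le_succ _)).mono Set.subset_union_left) (mv.tb.mono Set.subset_union_left) (fun i hi => ?_) fun i hi => ?_)
      subset_rfl (Adder.proofSize_leibLines _ _ _ _)
    · show ctx K (eqv (Adder.zext (X W o₁) (f W o₁) (W + 1) i) (X W o₁ i)) ∈ Γ ∪ A1
      rw [Adder.zext_lt _ _ hi]; exact Or.inr (rX i hi)
    · show ctx K (eqv (Adder.extOut (P W o₃ b₃) (W + 1) i) (Adder.extOut (d₀ W o₁ o₂ o₃ m).C W i)) ∈ Γ ∪ A1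
      rw [Adder.extOut_lt (P W o₃ b₃) hi]; exact Or.inl (hsp₃ _ (List.mem_append_left _ (mem_eqW (a := (P W o₃ b₃).s) hi)))
  set A2 := A1 ∪ {χ | χ ∈ Adder.leibLines (d₃ W o₁ o₃ b₃ m).D (d₀ W o₁ o₂ o₃ m).D K (W + 1)} with hA2
  have m2 : ∀ k < 2 * (W + 1) + 1, ctx K (eqv ((d₃ W o₁ o₃ b₃ m).D.wire k) ((d₀ W o₁ o₂ o₃ m).D.wire k)) ∈ A2 := fun k hk =>
    Or.inr (Adder.mem_leibLines hk)
  -- r3: the top position of `TB'`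
  have r3 : G.Yields (Γ ∪ A2) ({ctx K (eqv ((d₃ W o₁ o₃ b₃ m).D.s (W + 1)) ((d₃ W o₁ o₃ b₃ m).D.c (W + 1)))} ∪
      {ctx K (neg (var ((d₃ W o₁ o₃ b₃ m).D.c (W + 1 + 1))))}) ((K.size + 10) + (K.size + 3)) :=
    topCC hG (d₃ W o₁ o₃ b₃ m).D (mv.tbp.mono Set.subset_union_left) (show Adder.zext (X W o₁) (f W o₁) (W + 1) (W + 1) = f W o₁ from Adder.zext_top _ _ _)
      (show Adder.extOut (P W o₃ b₃) (W + 1) (W + 1) = (P W o₃ b₃).c (W + 1) from Adder.extOut_top _ _)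
      (Or.inl hf₁) (Or.inl (hsp₃ _ (List.mem_append_right _ (List.mem_singleton_self _))))
  set A3 := A2 ∪ ({ctx K (eqv ((d₃ W o₁ o₃ b₃ m).D.s (W + 1)) ((d₃ W o₁ o₃ b₃ m).D.c (W + 1)))} ∪
    {ctx K (neg (var ((d₃ W o₁ o₃ b₃ m).D.c (W + 1 + 1))))}) with hA3
  -- r4: `s_{W+1}(TB') ↔ c_{W+1}(TB)`
  have r4 : G.Yields (Γ ∪ A3) {ctx K (eqv ((d₃ W o₁ o₃ b₃ m).D.s (W + 1)) ((d₀ W o₁ o₂ o₃ m).D.c (W + 1)))} (K.size + 10) :=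
    eqvTrans hG (y := (d₃ W o₁ o₃ b₃ m).D.c (W + 1)) (Or.inr (Or.inr (Or.inl rfl))) (Or.inr (Or.inl (m2 (2 * (W + 1)) (by omega))))
  set A4 := A3 ∪ {ctx K (eqv ((d₃ W o₁ o₃ b₃ m).D.s (W + 1)) ((d₀ W o₁ o₂ o₃ m).D.c (W + 1)))} with hA4
  -- r5: associativity `(X + U₃) + N₃ = X + (U₃ + N₃)`: `s(VRp) = s(TB')`
  have r5 : G.Yields (Γ ∪ A4) {χ | χ ∈ (d₃ W o₁ o₃ b₃ m).lines K} ((2 * (W + 1) + 3) * (K.size + 60)) :=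
    Yields.of_isBlock (Adder.AssocData.isBlock_lines hG.adderLaw (d₃ W o₁ o₃ b₃ m) (mv.q3.mono Set.subset_union_left)
      (mv.vrp.mono Set.subset_union_left) (sv₃.adder.mono Set.subset_union_left) (mv.tbp.mono Set.subset_union_left) (Or.inl hf₁))
      subset_rfl (Adder.AssocData.proofSize_lines _ _)
  set A5 := A4 ∪ {χ | χ ∈ (d₃ W o₁ o₃ b₃ m).lines K} with hA5
  -- r6: `Q₃ = X + U₃` and `x + u₃` agree on the low `2W+1` wires
  have r6 : G.Yields (Γ ∪ A5) {χ | χ ∈ Adder.leibLines (d₃ W o₁ o₃ b₃ m).A (A W o₄) K W} ((2 * W + 1) * (K.size + 10)) := by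
    refine Yields.of_isBlock (Adder.isBlock_leibLines hG.netlist (d₃ W o₁ o₃ b₃ m).A (A W o₄)
      ((mv.q3.of_le (Nat.le_succ W)).mono Set.subset_union_left) (v₄.adder.mono Set.subset_union_left) (fun i hi => ?_) fun i hi => ?_)
      subset_rfl (Adder.proofSize_leibLines _ _ _ _)
    · show ctx K (eqv (X W o₁ i) (o₄.inp i)) ∈ Γ ∪ A5
      rw [X, Adder.zext_lt _ _ hi, h₄x i hi]; exact Or.inr (Or.inl (Or.inl (Or.inl (Or.inl (rx i hi)))))
    · show ctx K (eqv (U₃ W o₃ i) (o₄.inp (W + i))) ∈ Γ ∪ A5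
      rw [U₃, Adder.zext_lt _ _ hi, h₄y i hi]; exact Or.inr (Or.inl (Or.inl (Or.inl (Or.inl (ru i hi)))))
  set A6 := A5 ∪ {χ | χ ∈ Adder.leibLines (d₃ W o₁ o₃ b₃ m).A (A W o₄) K W} with hA6
  -- r7: the top position of `Q₃` (over `f₁` and `f₃`)
  have r7 : G.Yields (Γ ∪ A6) ({ctx K (eqv ((d₃ W o₁ o₃ b₃ m).A.s W) ((d₃ W o₁ o₃ b₃ m).A.c W))} ∪
      {ctx K (neg (var ((d₃ W o₁ o₃ b₃ m).A.c (W + 1))))}) ((K.size + 10) + (K.size + 3)) :=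
    topCC hG (d₃ W o₁ o₃ b₃ m).A (mv.q3.mono Set.subset_union_left) (show X W o₁ W = f W o₁ from Adder.zext_top _ _ _)
      (show U₃ W o₃ W = f W o₃ from Adder.zext_top _ _ _) (Or.inl hf₁) (Or.inl hf₃)
  set A7 := A6 ∪ ({ctx K (eqv ((d₃ W o₁ o₃ b₃ m).A.s W) ((d₃ W o₁ o₃ b₃ m).A.c W))} ∪
    {ctx K (neg (var ((d₃ W o₁ o₃ b₃ m).A.c (W + 1))))}) with hA7
  -- r8: glue `extOut Q₃ = extOut P₄`
  have r8 : G.Yields (Γ ∪ A7) (ctxSet K (glueBodies W (d₃ W o₁ o₃ b₃ m).A o₄ b₄)) ((2 * W + 6) * (K.size + 10)) :=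
    glue hG (d₃ W o₁ o₃ b₃ m).A o₄ b₄ (fun k hk => Or.inr (Or.inl (Or.inr (Adder.mem_leibLines hk)))) (Or.inr (Or.inr (Or.inl rfl)))
      (Or.inr (Or.inr (Or.inr rfl))) (hsp₄.mono Set.subset_union_left)
  set A8 := A7 ∪ ctxSet K (glueBodies W (d₃ W o₁ o₃ b₃ m).A o₄ b₄) with hA8
  -- r9: congruence `VRp = VR`
  have r9 : G.Yields (Γ ∪ A8) {χ | χ ∈ Adder.leibLines (d₃ W o₁ o₃ b₃ m).B (VR W o₁ o₃ o₄ b₃ b₄ m) K (W + 2)} ((2 * (W + 2) + 1) * (K.size + 10)) := by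
    have hg := holds_ext_of_glue (holds_ctxSet (Set.subset_union_right.trans (Set.subset_union_right (s := Γ))) :
      Holds K (Γ ∪ A8) (glueBodies W (d₃ W o₁ o₃ b₃ m).A o₄ b₄))
    refine Yields.of_isBlock (Adder.isBlock_leibLines hG.netlist (d₃ W o₁ o₃ b₃ m).B (VR W o₁ o₃ o₄ b₃ b₄ m) (mv.vrp.mono Set.subset_union_left)
      (mv.vr.mono Set.subset_union_left) (fun i hi => holds_eqW_iff.1 hg i hi) fun i hi => ?_) subset_rfl (Adder.proofSize_leibLines _ _ _ _)
    exact Or.inr (Or.inl (Or.inl (Or.inl (Or.inl (Or.inl (Or.inl (Or.inl (rN i hi))))))))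
  set A9 := A8 ∪ {χ | χ ∈ Adder.leibLines (d₃ W o₁ o₃ b₃ m).B (VR W o₁ o₃ o₄ b₃ b₄ m) K (W + 2)} with hA9
  -- r10: `s(VR) = s(VRp) = s(TB')`
  have r10a : G.Yields (Γ ∪ A9) (ctxSet K (eqW (VR W o₁ o₃ o₄ b₃ b₄ m).s (d₃ W o₁ o₃ b₃ m).B.s (W + 2))) ((W + 2) * (K.size + 10)) :=
    Yields.eqW_symm hG.logic (holds_eqW_iff.2 fun i hi => Or.inr (Or.inr (Adder.mem_leibLines (k := 2 * i + 1) (by omega))))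
  set A10 := A9 ∪ ctxSet K (eqW (VR W o₁ o₃ o₄ b₃ b₄ m).s (d₃ W o₁ o₃ b₃ m).B.s (W + 2)) with hA10
  have r10b : G.Yields (Γ ∪ A10) (ctxSet K (eqW (VR W o₁ o₃ o₄ b₃ b₄ m).s (d₃ W o₁ o₃ b₃ m).D.s (W + 2))) ((W + 2) * (K.size + 10)) :=
    Yields.eqW_trans hG.logic (b := (d₃ W o₁ o₃ b₃ m).B.s) (holds_eqW_iff.2 fun i hi => Or.inr (Or.inr (mem_ctxSet (mem_eqW hi))))
      (holds_eqW_iff.2 fun i hi => Or.inr (Or.inl (Or.inl (Or.inl (Or.inl (Or.inl (Or.inr ((d₃ W o₁ o₃ b₃ m).sum_mem_lines K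
        (by show i ≤ W + 1; omega)))))))))
  set A11 := A10 ∪ ctxSet K (eqW (VR W o₁ o₃ o₄ b₃ b₄ m).s (d₃ W o₁ o₃ b₃ m).D.s (W + 2)) with hA11
  -- r11: the final transitivities
  have r11a : G.Yields (Γ ∪ A11) (ctxSet K ((List.range (W + 1)).map fun i => eqv ((VR W o₁ o₃ o₄ b₃ b₄ m).s i) ((d₀ W o₁ o₂ o₃ m).D.s i)))
      ((W + 1) * (K.size + 9 + 1)) :=
    Yields.ctx_range
      (fun i hi => Or.inr (Logic.infer hG.logic 6 (by decide)
        (FregeSystem.sub [K, var ((VR W o₁ o₃ o₄ b₃ b₄ m).s i), var ((d₃ W o₁ o₃ b₃ m).D.s i), var ((d₀ W o₁ o₂ o₃ m).D.s i)]) rfl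
        (FregeSystem.prems_cons
          (Or.inr (Or.inr (mem_ctxSet (mem_eqW (a := (VR W o₁ o₃ o₄ b₃ b₄ m).s) (by omega)))))
          (FregeSystem.prems_cons
            (Or.inr (Or.inl (Or.inl (Or.inl (Or.inl (Or.inl (Or.inl (Or.inl (Or.inl (Or.inl (m2 (2 * i + 1) (by omega))))))))))))
            FregeSystem.prems_nil))))
      fun _ _ => (size_eqv _ _).le
  set A12 := A11 ∪ ctxSet K ((List.range (W + 1)).map fun i => eqv ((VR W o₁ o₃ o₄ b₃ b₄ m).s i) ((d₀ W o₁ o₂ o₃ m).D.s i)) with hA12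
  have r11b : G.Yields (Γ ∪ A12) {ctx K (eqv ((VR W o₁ o₃ o₄ b₃ b₄ m).s (W + 1)) ((d₀ W o₁ o₂ o₃ m).D.c (W + 1)))} (K.size + 10) :=
    eqvTrans hG (y := (d₃ W o₁ o₃ b₃ m).D.s (W + 1))
      (Or.inr (Or.inl (Or.inr (mem_ctxSet (mem_eqW (a := (VR W o₁ o₃ o₄ b₃ b₄ m).s) (by omega))))))
      (Or.inr (Or.inl (Or.inl (Or.inl (Or.inl (Or.inl (Or.inl (Or.inl (Or.inl (Or.inr rfl))))))))))
  have h := ((((((((((((r1.trans r2).trans r3).trans r4).trans r5).trans r6).trans r7).trans r8).trans r9).trans r10a).trans r10b).trans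
    r11a).trans r11b)
  refine (h.mono_right ?_).mono_size (by nlinarith [Nat.zero_le W, Nat.zero_le K.size])
  rintro θ ⟨L, hL, rfl⟩
  rcases List.mem_append.1 hL with hL | hL
  · exact Or.inl (Or.inr (mem_ctxSet hL))
  · rw [List.mem_singleton.1 hL]; exact Or.inr rfl

end Right

/-! ### The identity between the sums -/

section Main

variable {G : FregeSystem} {K : PropForm ℕ} {Γ : Set (PropForm ℕ)} {W : ℕ} {o₁ o₂ o₃ o₄ b₁ b₂ b₃ b₄ m : Occ}

/-- `OShape W o₁ o₂ o₃ o₄`: the four occurrences have the shapes of the associativity law — `o₂` reads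
the result of `o₁` and `z`, `o₃` reads `y, z`, `o₄` reads `x` and the result of `o₃`, all with the
same `n`. [folklore] -/
structure OShape (W : ℕ) (o₁ o₂ o₃ o₄ : Occ) : Prop where
  /-- `o₂ = u₁ ⊕ z` -/
  h₂x : ∀ i < W, o₂.inp i = u W o₁ i
  /-- `o₃ = y ⊕ z` -/
  h₃x : ∀ i < W, o₃.inp i = o₁.inp (W + i)
  /-- the `z` of `o₃` is the `z` of `o₂` -/
  h₃y : ∀ i < W, o₃.inp (W + i) = o₂.inp (W + i)
  /-- `o₄ = x ⊕ u₃` -/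
  h₄x : ∀ i < W, o₄.inp i = o₁.inp i
  /-- second operand of `o₄` -/
  h₄y : ∀ i < W, o₄.inp (W + i) = u W o₃ i
  /-- same `n` -/
  h₂n : ∀ i < W, o₂.inp (2 * W + i) = o₁.inp (2 * W + i)
  /-- same `n` -/
  h₃n : ∀ i < W, o₃.inp (2 * W + i) = o₁.inp (2 * W + i)
  /-- same `n` -/
  h₄n : ∀ i < W, o₄.inp (2 * W + i) = o₁.inp (2 * W + i)

/-- **The identity between ordinary sums** (first half of associativity of `⊕ₙ`): the sum bits of
`VL = (L' + N₂) + N₁` and `VR = (R' + N₄) + N₃` are provably equal, both being `x + y + z`.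
[cite: CookReckhow1979, §2] [cite: Krajicek1995, §9.2] -/
theorem main (hG : ARulesOK G) (hsh : OShape W o₁ o₂ o₃ o₄) (v₁ : Views W o₁ K Γ) (v₂ : Views W o₂ K Γ) (v₃ : Views W o₃ K Γ)
    (v₄ : Views W o₄ K Γ) (sv₁ : SplitViews W o₁ b₁ K Γ) (sv₃ : SplitViews W o₃ b₃ K Γ) (mv : MainViews W o₁ o₂ o₃ o₄ b₁ b₂ b₃ b₄ m K Γ)
    (hsp₁ : Holds K Γ (splitBodies W o₁ b₁)) (hsp₂ : Holds K Γ (splitBodies W o₂ b₂)) (hsp₃ : Holds K Γ (splitBodies W o₃ b₃))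
    (hsp₄ : Holds K Γ (splitBodies W o₄ b₄)) :
    G.Yields Γ (ctxSet K (eqW (VL W o₁ o₂ b₁ b₂ m).s (VR W o₁ o₃ o₄ b₃ b₄ m).s (W + 2))) ((66 * W + 140) * (K.size + 60)) := by
  -- the literals of the two `⊥` gates
  have l := (Yields.lit_of_cstDef hG.logic v₁.bot (Γ := Γ)).union (Yields.lit_of_cstDef hG.logic v₃.bot)
  set A1 : Set (PropForm ℕ) := {ctx K (lit (f W o₁) false)} ∪ {ctx K (lit (f W o₃) false)} with hA1
  have hf₁ : ctx K (neg (var (f W o₁))) ∈ Γ ∪ A1 := Or.inr (Or.inl rfl)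
  have hf₃ : ctx K (neg (var (f W o₃))) ∈ Γ ∪ A1 := Or.inr (Or.inr rfl)
  have hΓ : Γ ⊆ Γ ∪ A1 := Set.subset_union_left
  -- left and right chains
  have cl := leftChain hG (v₂.mono hΓ) (sv₁.mono hΓ) (mv.mono hΓ) (hsp₁.mono hΓ) (hsp₂.mono hΓ) hf₁ hsh.h₂x
  set A2 := A1 ∪ ctxSet K (leftBodies W o₁ o₂ o₃ b₁ b₂ m) with hA2
  have hΓ₂ : Γ ⊆ Γ ∪ A2 := Set.subset_union_left
  have cr := rightChain hG (v₄.mono hΓ₂) (sv₃.mono hΓ₂) (mv.mono hΓ₂) (hsp₃.mono hΓ₂) (hsp₄.mono hΓ₂) (Or.inr (Or.inl (Or.inl rfl)))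
    (Or.inr (Or.inl (Or.inr rfl))) hsh.h₄x hsh.h₄y
  set A3 := A2 ∪ ctxSet K (rightBodies W o₁ o₂ o₃ o₄ b₃ b₄ m) with hA3
  -- associativity `(x + y) + z = x + (y + z)`
  have ca : G.Yields (Γ ∪ A3) {χ | χ ∈ (d₀ W o₁ o₂ o₃ m).lines K} ((2 * W + 3) * (K.size + 60)) :=
    Yields.of_isBlock (Adder.AssocData.isBlock_lines hG.adderLaw (d₀ W o₁ o₂ o₃ m) (v₁.adder.mono Set.subset_union_left)
      (mv.ta.mono Set.subset_union_left)
      ((v₃.adder.congr (V' := (d₀ W o₁ o₂ o₃ m).C) rfl (fun i hi => (hsh.h₃x i hi).symm) fun i hi => (hsh.h₃y i hi).symm).mono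
        Set.subset_union_left)
      (mv.tb.mono Set.subset_union_left) (Or.inr (Or.inl (Or.inl (Or.inl rfl))))) subset_rfl (Adder.AssocData.proofSize_lines _ _)
  set A4 := A3 ∪ {χ | χ ∈ (d₀ W o₁ o₂ o₃ m).lines K} with hA4
  -- c1: `s(VL) = extOut TB`
  have c1a : G.Yields (Γ ∪ A4) (ctxSet K ((List.range (W + 1)).map fun i => eqv ((VL W o₁ o₂ b₁ b₂ m).s i) ((d₀ W o₁ o₂ o₃ m).D.s i)))
      ((W + 1) * (K.size + 9 + 1)) :=
    Yields.ctx_range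
      (fun i hi => Or.inr (Logic.infer hG.logic 6 (by decide)
        (FregeSystem.sub [K, var ((VL W o₁ o₂ b₁ b₂ m).s i), var ((d₀ W o₁ o₂ o₃ m).B.s i), var ((d₀ W o₁ o₂ o₃ m).D.s i)]) rfl
        (FregeSystem.prems_cons
          (Or.inr (Or.inl (Or.inl (Or.inr (mem_ctxSet (List.mem_append_left _ (List.mem_map.2 ⟨i, List.mem_range.2 hi, rfl⟩)))))))
          (FregeSystem.prems_cons (Or.inr (Or.inr ((d₀ W o₁ o₂ o₃ m).sum_mem_lines K (by show i ≤ W; omega))))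
            FregeSystem.prems_nil))))
      fun _ _ => (size_eqv _ _).le
  set A5 := A4 ∪ ctxSet K ((List.range (W + 1)).map fun i => eqv ((VL W o₁ o₂ b₁ b₂ m).s i) ((d₀ W o₁ o₂ o₃ m).D.s i)) with hA5
  have c1b : G.Yields (Γ ∪ A5) {ctx K (eqv ((VL W o₁ o₂ b₁ b₂ m).s (W + 1)) ((d₀ W o₁ o₂ o₃ m).D.c (W + 1)))} (K.size + 10) :=
    eqvTrans hG (y := (d₀ W o₁ o₂ o₃ m).B.c (W + 1))
      (Or.inr (Or.inl (Or.inl (Or.inl (Or.inr (mem_ctxSet (List.mem_append_right _ (List.mem_singleton_self _))))))))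
      (Or.inr (Or.inl (Or.inr ((d₀ W o₁ o₂ o₃ m).carry_mem_lines K))))
  set A6 := A5 ∪ {ctx K (eqv ((VL W o₁ o₂ b₁ b₂ m).s (W + 1)) ((d₀ W o₁ o₂ o₃ m).D.c (W + 1)))} with hA6
  -- c2: `extOut TB = s(VR)` (the right chain reversed)
  have c2a : G.Yields (Γ ∪ A6) (ctxSet K ((List.range (W + 1)).map fun i => eqv ((d₀ W o₁ o₂ o₃ m).D.s i) ((VR W o₁ o₃ o₄ b₃ b₄ m).s i)))
      ((W + 1) * (K.size + 9 + 1)) :=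
    Yields.ctx_range
      (fun i hi => Or.inr (Logic.infer hG.logic 5 (by decide)
        (FregeSystem.sub [K, var ((VR W o₁ o₃ o₄ b₃ b₄ m).s i), var ((d₀ W o₁ o₂ o₃ m).D.s i)]) rfl
        (FregeSystem.prems_cons
          (Or.inr (Or.inl (Or.inl (Or.inl (Or.inr (mem_ctxSet (List.mem_append_left _ (List.mem_map.2 ⟨i, List.mem_range.2 hi, rfl⟩))))))))
          FregeSystem.prems_nil)))
      fun _ _ => (size_eqv _ _).le
  set A7 := A6 ∪ ctxSet K ((List.range (W + 1)).map fun i => eqv ((d₀ W o₁ o₂ o₃ m).D.s i) ((VR W o₁ o₃ o₄ b₃ b₄ m).s i)) with hA7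
  have c2b : G.Yields (Γ ∪ A7) {ctx K (eqv ((d₀ W o₁ o₂ o₃ m).D.c (W + 1)) ((VR W o₁ o₃ o₄ b₃ b₄ m).s (W + 1)))} (K.size + 10) :=
    eqvSymm hG (Or.inr (Or.inl (Or.inl (Or.inl (Or.inl (Or.inr (mem_ctxSet (List.mem_append_right _ (List.mem_singleton_self _)))))))))
  set A8 := A7 ∪ {ctx K (eqv ((d₀ W o₁ o₂ o₃ m).D.c (W + 1)) ((VR W o₁ o₃ o₄ b₃ b₄ m).s (W + 1)))} with hA8
  -- c3: `s(VL) = s(VR)`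
  have c3a : G.Yields (Γ ∪ A8) (ctxSet K ((List.range (W + 1)).map fun i => eqv ((VL W o₁ o₂ b₁ b₂ m).s i) ((VR W o₁ o₃ o₄ b₃ b₄ m).s i)))
      ((W + 1) * (K.size + 9 + 1)) :=
    Yields.ctx_range
      (fun i hi => Or.inr (Logic.infer hG.logic 6 (by decide)
        (FregeSystem.sub [K, var ((VL W o₁ o₂ b₁ b₂ m).s i), var ((d₀ W o₁ o₂ o₃ m).D.s i), var ((VR W o₁ o₃ o₄ b₃ b₄ m).s i)]) rfl
        (FregeSystem.prems_cons
          (Or.inr (Or.inl (Or.inl (Or.inl (Or.inr (mem_ctxSet (List.mem_map.2 ⟨i, List.mem_range.2 hi, rfl⟩)))))))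
          (FregeSystem.prems_cons (Or.inr (Or.inl (Or.inr (mem_ctxSet (List.mem_map.2 ⟨i, List.mem_range.2 hi, rfl⟩)))))
            FregeSystem.prems_nil))))
      fun _ _ => (size_eqv _ _).le
  set A9 := A8 ∪ ctxSet K ((List.range (W + 1)).map fun i => eqv ((VL W o₁ o₂ b₁ b₂ m).s i) ((VR W o₁ o₃ o₄ b₃ b₄ m).s i)) with hA9
  have c3b : G.Yields (Γ ∪ A9) {ctx K (eqv ((VL W o₁ o₂ b₁ b₂ m).s (W + 1)) ((VR W o₁ o₃ o₄ b₃ b₄ m).s (W + 1)))} (K.size + 10) :=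
    eqvTrans hG (y := (d₀ W o₁ o₂ o₃ m).D.c (W + 1)) (Or.inr (Or.inl (Or.inl (Or.inl (Or.inr rfl))))) (Or.inr (Or.inl (Or.inr rfl)))
  have h := ((((((((l.trans cl).trans cr).trans ca).trans c1a).trans c1b).trans c2a).trans c2b).trans c3a).trans c3b
  refine (h.mono_right ?_).mono_size (by nlinarith [Nat.zero_le W, Nat.zero_le K.size])
  rintro θ ⟨L, hL, rfl⟩
  obtain ⟨i, hi, rfl⟩ := List.mem_map.1 hL
  rcases Nat.lt_succ_iff_lt_or_eq.1 (List.mem_range.1 hi) with hi' | hi'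
  · exact Or.inl (Or.inr (mem_ctxSet (List.mem_map.2 ⟨i, List.mem_range.2 hi', rfl⟩)))
  · rw [hi']; exact Or.inr rfl

end Main

end AssocMain

end ModAdd

end Literature.Computability.MetaComplexity
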